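import Summits.RiemannHypothesis.RiemannHypothesis.Theses.WeilGroundState
import Summits.RiemannHypothesis.RiemannHypothesis.Theorems.GroundStateSimpleEven.Negative.LoadBearingAndParity
import Literature.NumberTheory.LFunctions.WeilGroundState
import Literature.NumberTheory.LFunctions.WeilSemilocalCompactness
import Literature.NumberTheory.LFunctions.WeilGroundEnergyParitySplit
import Summits.RiemannHypothesis.RiemannHypothesis.Theorems.WeilGroundStateGroundStateSimpleEvenStubCompact
import Summits.RiemannHypothesis.RiemannHypothesis.Theorems.WeilGroundStateGroundStateSimpleEvenStubIntertwine
import Summits.RiemannHypothesis.RiemannHypothesis.Theorems.WeilGroundStateGroundStateSimpleEvenStubPair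
import Summits.RiemannHypothesis.RiemannHypothesis.Theorems.WeilGroundStateGroundStateSimpleEvenOfOddSectorGap
import Summits.RiemannHypothesis.RiemannHypothesis.Theorems.WeilGroundStateGroundStateSimpleEvenCellTransfer
import Summits.RiemannHypothesis.RiemannHypothesis.Theorems.WeilGroundStateGroundStateSimpleEvenArch
import Summits.RiemannHypothesis.RiemannHypothesis.Theorems.WeilGroundStateGroundStateSimpleEvenStubArchTail
import Summits.RiemannHypothesis.RiemannHypothesis.Theorems.WeilGroundStateGroundStateSimpleEvenStubArchTailBound
import Summits.RiemannHypothesis.RiemannHypothesis.Theorems.WeilGroundStateGroundStateSimpleEvenStubArctanLogBounds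
import Summits.RiemannHypothesis.RiemannHypothesis.Theorems.WeilGroundStateGroundStateSimpleEvenStubBathtub
import Summits.RiemannHypothesis.RiemannHypothesis.Theorems.WeilGroundStateGroundStateSimpleEvenStubDigammaMinorant
import Summits.RiemannHypothesis.RiemannHypothesis.Theorems.WeilGroundStateGroundStateSimpleEvenStubHyperbolicBounds
import Summits.RiemannHypothesis.RiemannHypothesis.Theorems.WeilGroundStateGroundStateSimpleEvenStubLogAtoms
import Summits.RiemannHypothesis.RiemannHypothesis.Theorems.WeilGroundStateGroundStateSimpleEvenStubMarkovConstant
import Summits.RiemannHypothesis.RiemannHypothesis.Theorems.WeilGroundStateGroundStateSimpleEvenStubOddEnvelope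
import Summits.RiemannHypothesis.RiemannHypothesis.Theorems.WeilGroundStateGroundStateSimpleEvenStubOddLowerGeneric
import Summits.RiemannHypothesis.RiemannHypothesis.Theorems.WeilGroundStateGroundStateSimpleEvenStubParabolaEnergy
import Summits.RiemannHypothesis.RiemannHypothesis.Theorems.WeilGroundStateGroundStateSimpleEvenStubParabolaRayleigh
import Summits.RiemannHypothesis.RiemannHypothesis.Theorems.WeilGroundStateGroundStateSimpleEvenStubPieceIntegrals
import Summits.RiemannHypothesis.RiemannHypothesis.Theorems.WeilGroundStateGroundStateSimpleEvenStubSinPanels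
import Summits.RiemannHypothesis.RiemannHypothesis.Theorems.WeilGroundStateGroundStateSimpleEvenStubSinTaylor
import Summits.RiemannHypothesis.RiemannHypothesis.Theorems.WeilGroundStateGroundStateSimpleEvenArchCapExists
import Summits.RiemannHypothesis.RiemannHypothesis.Theorems.WeilGroundStateGroundStateSimpleEvenArchAtoms
import Summits.RiemannHypothesis.RiemannHypothesis.Theorems.WeilGroundStateGroundStateSimpleEvenArchAtomsCalc
import Summits.RiemannHypothesis.RiemannHypothesis.Theorems.WeilGroundStateGroundStateSimpleEvenArchAtomsLorentz
import Summits.RiemannHypothesis.RiemannHypothesis.Theorems.WeilGroundStateGroundStateSimpleEvenArchCapPieces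
import Summits.RiemannHypothesis.RiemannHypothesis.Theorems.WeilGroundStateGroundStateSimpleEvenArchCapValidA
import Summits.RiemannHypothesis.RiemannHypothesis.Theorems.WeilGroundStateGroundStateSimpleEvenArchCapValidB
import Summits.RiemannHypothesis.RiemannHypothesis.Theorems.WeilGroundStateGroundStateSimpleEvenArchMass
import Summits.RiemannHypothesis.RiemannHypothesis.Theorems.WeilGroundStateGroundStateSimpleEvenArchKlog
import Summits.RiemannHypothesis.RiemannHypothesis.Theorems.WeilGroundStateGroundStateSimpleEvenArchLorentzP1
import Summits.RiemannHypothesis.RiemannHypothesis.Theorems.WeilGroundStateGroundStateSimpleEvenArchLorentzP2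
import Summits.RiemannHypothesis.RiemannHypothesis.Theorems.WeilGroundStateGroundStateSimpleEvenArchLorentzM
import Summits.RiemannHypothesis.RiemannHypothesis.Theorems.WeilGroundStateGroundStateSimpleEvenArchOddLowerPrep
import Summits.RiemannHypothesis.RiemannHypothesis.Theorems.WeilGroundStateGroundStateSimpleEvenArchEvenUpper
import Summits.RiemannHypothesis.RiemannHypothesis.Theorems.WeilGroundStateGroundStateSimpleEvenArchOddLowerB
import Literature.NumberTheory.LFunctions.WeilFirstPrimeCertificateZ
import Literature.NumberTheory.LFunctions.WeilFirstPrimeCertificateDataC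
import Literature.NumberTheory.LFunctions.WeilFirstPrimeCertificateCCheck
import Literature.NumberTheory.LFunctions.WeilFirstPrimeQuadratic
import Summits.RiemannHypothesis.RiemannHypothesis.Theorems.WeilGroundStateGroundStateSimpleEvenRhoMajorant
import Summits.RiemannHypothesis.RiemannHypothesis.Theorems.WeilGroundStateGroundStateSimpleEvenKillingIntegral
import Summits.RiemannHypothesis.RiemannHypothesis.Theorems.WeilGroundStateGroundStateSimpleEvenMarkovFirstPrime
import Summits.RiemannHypothesis.RiemannHypothesis.Theorems.WeilGroundStateGroundStateSimpleEvenArchTailAt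
import Summits.RiemannHypothesis.RiemannHypothesis.Theorems.WeilGroundStateGroundStateSimpleEvenCoshHalfBounds
import Summits.RiemannHypothesis.RiemannHypothesis.Theorems.WeilGroundStateGroundStateSimpleEvenIncrementSplit
import Summits.RiemannHypothesis.RiemannHypothesis.Theorems.WeilGroundStateGroundStateSimpleEvenOddMarginSound
import Summits.RiemannHypothesis.RiemannHypothesis.Theorems.WeilGroundStateGroundStateSimpleEvenCheckNuTransfer
import Summits.RiemannHypothesis.RiemannHypothesis.Theorems.WeilGroundStateGroundStateSimpleEvenTrialUpperA
import Summits.RiemannHypothesis.RiemannHypothesis.Theorems.WeilGroundStateGroundStateSimpleEvenTrialUpperB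
import Summits.RiemannHypothesis.RiemannHypothesis.Theorems.WeilGroundStateGroundStateSimpleEvenTrialUpperD
import Summits.RiemannHypothesis.RiemannHypothesis.Theorems.WeilGroundStateGroundStateSimpleEvenTrialUpperC
import Summits.RiemannHypothesis.RiemannHypothesis.Theorems.WeilGroundStateGroundStateSimpleEvenOddLowerA
import Summits.RiemannHypothesis.RiemannHypothesis.Theorems.WeilGroundStateGroundStateSimpleEvenOddLowerB
import Summits.RiemannHypothesis.RiemannHypothesis.Theorems.WeilGroundStateGroundStateSimpleEvenOddLowerC
import Summits.RiemannHypothesis.RiemannHypothesis.Theorems.WeilGroundStateGroundStateSimpleEvenOddLowerD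
import Summits.RiemannHypothesis.RiemannHypothesis.Theorems.WeilGroundStateGroundStateSimpleEvenFirstPrimeWindows
import Summits.RiemannHypothesis.RiemannHypothesis.Theorems.WeilGroundStateGroundStateSimpleEvenOfNoParityCrossing
import Summits.RiemannHypothesis.RiemannHypothesis.Theorems.WeilGroundStateGroundStateSimpleEvenTrialUpperE
import Summits.RiemannHypothesis.RiemannHypothesis.Theorems.WeilGroundStateGroundStateSimpleEvenTrialUpperF
import Summits.RiemannHypothesis.RiemannHypothesis.Theorems.WeilGroundStateGroundStateSimpleEvenOddLowerE
import Summits.RiemannHypothesis.RiemannHypothesis.Theorems.WeilGroundStateGroundStateSimpleEvenOddLowerF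
import Summits.RiemannHypothesis.RiemannHypothesis.Theorems.WeilGroundStateGroundStateSimpleEvenTwoPrimeWindows
import HarnessLib

/-!
# Crux `GroundStateSimpleEven` (stmt-RiemannHypothesis-1526) — skeleton of line
# `parity-multiplicity-commutator`, v6 (v2 lead c1: EDGE bypassed by INTEGRATION; v3–v5 leads c2/c3: ORDER split at the primes 2, 3; v6 lead c4: residue = item 18085)

The crux is `∀ a > 0, WeilWindowSimpleEven a` (`Iff.rfl`): at every window the bottom
`ε(a) = weilGroundEnergy a` of `Re Q`, `Q g = W(g ⋆ g̃)`, is simple, isolated and even —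
variationally: a witness `φ` and a gap `δ > 0` push every normalised ODD window test function, and
every normalised EVEN one with `∫ conj φ · g = 0`, to `Re Q ≥ ε(a) + δ`.

## The line (one sentence), v2

SIMPLE-EVEN is bookkeeping on top of ORDER.  v1 (planner / lead a1) intertwined the even and the
odd sector with `d/dt` (continuum Connes–van Suijlekom commutator) and therefore needed the EDGE
lemma (one exact edge profile per level, so that a combination of two even ground states lies in
`H¹₀` with form-approximable derivative) — a crux-sized regularity theory.  v2 intertwines with the
ANTIDERIVATIVE instead: for two `L²`-orthogonal even ground states `u₁, u₂` at the same window pick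
`(c₁, c₂) ≠ 0` with `∫ (c₂u₁ − c₁u₂) = 0` (one scalar condition, always solvable: `cᵢ = ∫ uᵢ`, or
`(0, 1)` if both vanish); the window primitive `U(t) = ∫_{-a}^t (c₂u₁ − c₁u₂)` is ODD, continuous,
vanishes off the window, has `U' = c₂u₁ − c₁u₂ ∈ L²`, and — by the kernel identity
`W(P' ⋆ ψ̃) = −W(P ⋆ (ψ')̃)` read from right to left plus the weak Euler–Lagrange equation of
`c₂u₁ − c₁u₂` — satisfies the weak eigen-equation `W(U ⋆ χ̃) = ε(a)⟨U, χ⟩` against every odd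
window test `χ` (every such `χ` is the derivative of a window test).  No edge coefficient appears:
integration GAINS a derivative, and the only price, the constant of integration / boundary value
`∫_0^a`, is ONE scalar per function, killed by the two-dimensionality of the even eigenspace.  The
Weil form being of logarithmic order, it is bounded on `L² × H¹` of the window (pair continuity,
`‖W(f ⋆ h̃)‖ ≤ C‖f‖₂(‖h‖₂ + ‖h'‖₂)`), so the `H¹`-approximants of `U` by odd window tests are an
odd minimising sequence: `Re Q(oₙ) → ε(a)`.  Under ORDER (odd sector gapped) this is impossible,
so the even bottom is simple.  (For the Laplacian this argument fails exactly at the pair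
continuity: `U = ∫_0^t cos` has non-zero boundary values and infinite Dirichlet energy; for the
order-`0⁺` Weil form short indicators have energy `≍ h log(1/h) → 0` and boundary values are
invisible.)

## Composition (window-wise, then `∀ a`)

`weilWindowSimpleEven_of_order_of_oddMinimisers` (real proof): at a window `a > 0`,
  ORDER(a) ∧ COMPACT(a) ∧ PAIR(a) ⟹ `WeilWindowSimpleEven a`
with witness `φ := u₁`, an even ground state; `GroundStateSimpleEven_of` is the `∀ a` wrapper and
concludes the route decl `…Theses.WeilGroundState.GroundStateSimpleEven` BY NAME.

## Stubs (registered; v2/v3/v4) — after lead c2 only ORDER-LARGE (`stub_oddSectorGap_large`) carries a `sorry`;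
ARCH (`stub_archimedeanWindows`, every window `a ≤ (log 2)/2`) is LANDED (p145580) with its whole evaluation chain

## v5 (lead c3): ORDER-LARGE is split again, at the SECOND prime — after cycle 3 ONLY ORDER-BEYOND carries a `sorry`

* `stub_oddSectorGap_beyond` — ORDER for `a > (log 3)/2`: the RH-strength residue (B1; the prime 3
  enters, no certificate format exists in the tree, ε(a) < 6e-8 meets the 1e-7 precision floor of the
  Markov constants).
* `stub_firstPrimeWindows` — the crux on EVERY first-prime window `(log 2)/2 < a ≤ (log 3)/2` (lead;
  RH-free): four cells `[11/32, 2/5]`, `[2/5, 23/50]`, `[23/50, 51/100]`, `[51/100, (log 3)/2]` of the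
  landed cell transfer `weilWindowSimpleEven_on_cell_of_le`, each fed by
  (U) `stub_trialUpperX` — a Rayleigh–Ritz UPPER bound for `ε(b)` at the left end from one even
      polynomial × indicator trial function in the Markov form `Re Q = P + 𝓔_b − M_b‖·‖²`
      (form-domain bound `stub_formDomainPos`; increments are explicit polynomials in `t` on
      `[0, 2b]` (`stub_incrementSplit`), the jump density is capped by the polynomial majorant
      `stub_rhoMajorant`, the tail by `stub_archTailAt`, the pole term by `stub_coshHalfBounds`,
      the killing constant by `stub_killingIntegral` + `stub_markovFirstPrime`), and
  (L) `stub_oddLowerX` — a certified LOWER bound for the normalised ODD window tests at the right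
      end: an odd-sector MARGIN certificate = the kernel-checked moment-method certificate format
      `WeilCert3` of first-prime Weil positivity (Stage C, `weilCert3C`, a₀ = 563/1024 ≥ (log 3)/2,
      N = 99, T = 50: cells, Legendre blocks and — rescaled, `stub_checkNuTransfer` — moment table
      reused verbatim) restricted to the ODD block with the Bessel coefficient κ lowered to κ'
      (`stub_oddMarginSound`: `(κ − κ')‖g‖₂² ≤ E₂(g)` for odd `g`), the odd PSD factor regenerated
      for `S'_odd(κ')` at a₀ ∈ {2/5, 23/50, 51/100, 563/1024}.
  Numerics (this seat, pure rational arithmetic + 50-digit decimals, validated against the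
  disprover's table): e1(b) = 1.434e-3, 1.818e-4, 9.30e-6, 5.67e-7 at b = 11/32, 2/5, 23/50, 51/100;
  o1(c) = 1.474e-2, 1.563e-3, 1.096e-4, 1.508e-5 at c = 2/5, 23/50, 51/100, (log 3)/2 — cell ratios
  10.3, 8.6, 11.8, 26.6.  Certified constants (v5.1, after the generators ran): U = 53/10000, 3/10000,
  15/1000000, 17/5000000 and L = 1/100, 1/1000, 6/100000, 6/1000000 (certificate margins 1.0925e-2,
  1.0546e-3, 6.596e-5, 6.4896e-6 at a₀ = 2/5, 23/50, 51/100, 563/1024).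

## v6 (lead c4): the residue is the standing ITEM `NoParityCrossing` (stmt-RiemannHypothesis-18085)

* `stub_noParityCrossing` — `∀ a > (log 3)/2, ε_ev(a) ≠ ε_od(a)`: item 18085 of route WeilParity
  VERBATIM; the ONLY `sorry`.  Kernel-checked EQUIVALENT to the crux
  (`GroundStateSimpleEven.groundStateSimpleEven_iff_noParityCrossing`, p156985): two cruxes of two
  routes are one residue.  RH-strength as a ∀a statement (B1); item 18085 carries its own planner
  ladder (`stub_twoThreeWindowSimpleEven` on `((log 3)/2, log 2]`, RH-free heroic certificates — cell
  plan in this crux's NOTES.md; `stub_tailSimpleEven` on `a > log 2`, RH-strength).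
* `stub_oddSectorGapBeyond_of_noParityCrossing` — BRIDGE, LANDED p156985: no tie + certified anchor at
  `(log 3)/2` + landed sector continuity ⟹ ORDER for every `a > (log 3)/2` (IVT).
* `stub_oddSectorGap_beyond` (v5 residue) is now DERIVED: BRIDGE applied to NPC.

* `stub_oddSectorGap` — ORDER `∀ a > 0`.  IMPORTED, RH-STRENGTH for `∀ a` (BarrierNotes-r1-k1 B1;
  Disproof.lean §"Why it resists").  After v2 it is the WHOLE residue of the crux:
  `GroundStateSimpleEven ⟺ ∀ a > 0, ORDER(a) ⟺ every ground state at every window is a.e. even`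
  (`…OfOddSectorGap.lean`, p136723).
* `stub_evenGroundState_of_constrainedMinimisers` — COMPACT, LANDED p106119 (a1).
* `stub_oddPrimitive_approximants` — (OP) LANDED p135663; `stub_pairContinuity_polarPrime` — (PC1)
  LANDED p135583; `stub_pairContinuity_arch` — (PC2) LANDED p135667; `stub_pairContinuity`,
  `stub_windowPrimitive_ne_zero` — (PC, NZ) LANDED p135917.
* `stub_oddMinimisers_of_evenPair` — PAIR (lead c1), LANDED p136135: two `L²`-orthogonal even ground
  states at the same window yield an ODD normalised minimising sequence (antiderivative intertwiner).
* `stub_weilWindowSimpleEven_of_oddSectorGap` — HALVING, LANDED p136723 (with "parity decides" and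
  "evenness decides").
* `stub_cellTransfer` — CELL, LANDED p137020: `WeilWindowSimpleEven` on a whole cell `[b, c]` from
  `ε(b) ≤ U` (one trial function) and a certified odd lower bound `L > U` at `c`.
* `stub_cellThirdLogTwoHalf` — CELL-1/3, LANDED p137081: the crux on `[1/3, (log 2)/2]` from the two
  certificates of item 1529.

Retired (v1): `stub_evenPair_edgeCancellation` (EDGE; true but crux-sized, no longer needed) and
`stub_oddMinimisers_of_edgeCancelledPair` (INTERTWINE, landed p108701; superseded by PAIR).
Negative knowledge re-checked (Disproof.lean cycle 1 + `Negative/LoadBearingAndParity.lean`): every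
stub keeps normalisation, parity and support; none asserts a gap in both sectors
(`bottom_attained_in_a_sector`) nor an odd bottom (`not_oddGroundState`).
-/

noncomputable section

open Set MeasureTheory Filter
open scoped Real Topology ComplexConjugate

namespace Summit.RiemannHypothesis.RiemannHypothesis.Cruxes.GroundStateSimpleEven.ParityMultiplicityCommutator

open Literature.NumberTheory.LFunctions
open Summit.RiemannHypothesis.RiemannHypothesis.Theses.WeilGroundState
open Summit.RiemannHypothesis.Cruxes.GroundStateSimpleEven.Negative (bottom_attained_in_a_sector)

set_option linter.dupNamespace false

/-! ## The stubs -/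

/-! ### v3 (lead c2): ORDER is split at the first prime.  Below `(log 2)/2` it is PROVED by the
Fourier bathtub (stubs ENV, TUB, PSI, SIN, LOG, TAIL, TAILBD, PAR1, PAR2, MK → ARCH).
### v5 (lead c3): split again at the second prime.  On `((log 2)/2, (log 3)/2]` it is proved by
cells (odd-margin certificates + Rayleigh–Ritz upper bounds); beyond it stays the RH-strength residue
(ORDER-BEYOND).
### v6 (lead c4): ORDER-BEYOND is DERIVED from the standing item `NoParityCrossing`
(stmt-RiemannHypothesis-18085 of route WeilParity, statement verbatim = `stub_noParityCrossing`) through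
the provable-now bridge `stub_oddSectorGapBeyond_of_noParityCrossing` (IVT propagation from the certified
anchor `(log 3)/2` by the landed sector continuity; calibration file
`Theorems/WeilGroundStateGroundStateSimpleEvenOfNoParityCrossing.lean`:
`groundStateSimpleEven_iff_noParityCrossing`).  The crux is thereby closed MODULO ONE EXISTING ITEM. -/

/-! ### v7 (lead c5): the residue anchor moves beyond the second prime by TWO-PRIME CELLS.
Numerics (lead c5, `numerics/weilrr_f64.py`, geometric-side Rayleigh–Ritz validated against the disprover's
table): the slack of the Yoshida moment format is the constant level beyond the frequency cut-off `T`, and with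
the two-prime weight `w₂₃ = Re ψ(1/4+it/2) − √2 log 2 cos(t log 2) − (2 log 3/√3) cos(t log 3)` the level
`wL(T) = Re ψ(1/4+iT/2) − √2 log 2 − 2 log 3/√3` exceeds `log π` only for `T ≳ 62`; at `T = 80` the relaxed odd
bottom is `r(59/100) = 6.1e-7` (true `1.19e-6`) and `r(63/100) = 3.7e-8` (true `7.3e-8`), against even
Rayleigh–Ritz values `U₁₆(549/1000) = 5.96e-8`, `U₁₈(59/100) = 3.8e-9`.  Hence two cells with margin ≈ 6:
`E = [549/1000, 59/100]` (`U₁ = 8e-8 < L₁ = 5e-7`) and `F = [59/100, 63/100]` (`U₂ = 5e-9 < L₂ = 3e-8`), each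
`L` an odd-sector margin certificate in the two-prime format `WeilCert23` (= `WeilCert3` with cells for `w₂₃`,
analytic form `weilTwoPrimeQuadratic`, p153527) at `T = 80`, `N = 149/157`, and each `U` a windowed even
polynomial in the Markov form (first-prime form at `549/1000`, two-prime form `weilQuadratic_re_eq_twoPrime`,
p154067, at `59/100`).  The residue becomes `∀ a > 63/100, ε_ev a ≠ ε_od a` (still RH-strength as a `∀ a`
statement, B1); NPC (item 18085 verbatim) is DERIVED from the cells and the residue. -/

/-- **STUB (E-U) — Rayleigh–Ritz upper bound at the left end of cell E (provable now; worker).**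
`ε(549/1000) ≤ 8·10⁻⁸`: one windowed even polynomial of degree 16 (`U₁₆ = 5.96e-8`, true bottom `≈ 5.6e-8`) in the
first-prime Markov form `Re Q = P + (log 2/√2) D_{log 2} + ∫ρD − M_b‖·‖²` (`549/1000 < (log 3)/2`), template
`stub_trialUpperD` with the `ρ`-majorant, arch tail and constants sharpened to `≲ 3e-9` absolute. -/
theorem stub_trialUpperE : weilGroundEnergy (549 / 1000) ≤ 1 / 12500000 :=
  -- LANDED (worker B, p164969): Theorems/WeilGroundStateGroundStateSimpleEvenTrialUpperE.lean (certified 5.9559e-8;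
  -- helper stubs stub_trialUpperE_inputs p163573, stub_trialUpperE_arch p164433)
  Summit.RiemannHypothesis.RiemannHypothesis.Theorems.stub_trialUpperE

/-- **STUB (E-L) — odd-sector margin certificate at the right end of cell E (provable now; lead: data by kit,
kernel-checked rows).** Every `L²`-normalised ODD window-`59/100` test function has `Re Q ≥ 5·10⁻⁷`
(two-prime margin certificate `WeilCert23` at `a₀ = 59/100`, `T = 80`, `N = 149`; relaxed bottom `6.1e-7`). -/
theorem stub_oddLowerE :
    ∀ g : ℝ → ℂ, IsWeilTest g → tsupport g ⊆ Icc (-(59 / 100 : ℝ)) (59 / 100) →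
      ∫ x, ‖g x‖ ^ 2 = (1 : ℝ) → (∀ x, g (-x) = -g x) → (1 / 2000000 : ℝ) ≤ (weilQuadratic g).re :=
  -- LANDED (lead c5): Theorems/WeilGroundStateGroundStateSimpleEvenOddLowerE.lean — two-prime odd-margin certificate E
  -- (Literature/NumberTheory/LFunctions/WeilTwoPrimeOddMarginE*.lean, 248 cells on [0,80], N = 149, L_max = 6.065e-7)
  Summit.RiemannHypothesis.RiemannHypothesis.Theorems.stub_oddLowerE

/-- **STUB (F-U) — Rayleigh–Ritz upper bound at the left end of cell F (provable now; worker).**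
`ε(59/100) ≤ 5·10⁻⁹`: one windowed even polynomial of degree 18 (`U₁₈ = 3.8e-9`, true bottom `≈ 3.3e-9`) in the
TWO-prime Markov form `weilQuadratic_re_eq_twoPrime` (increments at `log 2` AND `log 3`), constants to `≲ 2e-10`. -/
theorem stub_trialUpperF : weilGroundEnergy (59 / 100) ≤ 1 / 200000000 :=
  -- LANDED (worker C, p165214): Theorems/WeilGroundStateGroundStateSimpleEvenTrialUpperF.lean (certified 3.82167e-9;
  -- helper stubs stub_rhoMajorantF p163718, stub_markovTwoPrimeF p163774, stub_archEnergyF p164506)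
  Summit.RiemannHypothesis.RiemannHypothesis.Theorems.stub_trialUpperF

/-- **STUB (F-L) — odd-sector margin certificate at the right end of cell F (provable now; lead).** Every
`L²`-normalised ODD window-`63/100` test function has `Re Q ≥ 3·10⁻⁸` (`WeilCert23` at `a₀ = 63/100`, `T = 80`,
`N = 157`; relaxed bottom `3.7e-8`). -/
theorem stub_oddLowerF :
    ∀ g : ℝ → ℂ, IsWeilTest g → tsupport g ⊆ Icc (-(63 / 100 : ℝ)) (63 / 100) →
      ∫ x, ‖g x‖ ^ 2 = (1 : ℝ) → (∀ x, g (-x) = -g x) → (3 / 100000000 : ℝ) ≤ (weilQuadratic g).re :=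
  -- LANDED (lead c5): Theorems/WeilGroundStateGroundStateSimpleEvenOddLowerF.lean — two-prime odd-margin certificate F
  -- (Literature/NumberTheory/LFunctions/WeilTwoPrimeOddMarginF*.lean, N = 157, L_max = 3.61e-8)
  Summit.RiemannHypothesis.RiemannHypothesis.Theorems.stub_oddLowerF

/-- **CELLS E, F (composition, no `sorry` of its own): the C–vS clause on `((log 3)/2, 63/100]`** by the landed cell
transfer `GroundStateSimpleEven.weilWindowSimpleEven_on_cell_of_le` (p137020). -/
theorem stub_cellsEF :
    ∀ a : ℝ, Real.log 3 / 2 < a → a ≤ 63 / 100 → WeilWindowSimpleEven a :=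
  -- LANDED (lead c5): Theorems/WeilGroundStateGroundStateSimpleEvenTwoPrimeWindows.lean (two cells of the cell transfer:
  -- stub_trialUpperE/stub_oddLowerE on [549/1000, 59/100], stub_trialUpperF/stub_oddLowerF on [59/100, 63/100];
  -- + weilWindowSimpleEven_of_le_63_100 and the calibration GroundStateSimpleEven ↔ no parity tie beyond 63/100)
  Summit.RiemannHypothesis.RiemannHypothesis.Theorems.stub_cellsEF

/-- **STUB (RESIDUE-F) — no parity tie beyond `63/100` (open; RH-strength as a `∀ a` statement, B1).** The v7
residue of the crux: `ε_ev(a) ≠ ε_od(a)` for every `a > 63/100`.  With cells E, F it gives item 18085 verbatim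
(`stub_noParityCrossing`, now derived). -/
theorem stub_noParityCrossing_beyondF :
    ∀ a : ℝ, 63 / 100 < a → weilEvenGroundEnergy a ≠ weilOddGroundEnergy a := by
  sorry

/-- **NPC = item stmt-RiemannHypothesis-18085 `NoParityCrossing` VERBATIM — v7: DERIVED from the two-prime cells
(`stub_cellsEF`) and the residue `stub_noParityCrossing_beyondF` (open; RH-strength as a `∀ a` statement, B1).** Beyond the second prime the even and the odd sector bottom never coincide:
`ε_ev(a) ≠ ε_od(a)` for every `a > (log 3)/2`.  Kernel-checked EQUIVALENT to the crux
(`GroundStateSimpleEven.groundStateSimpleEven_iff_noParityCrossing`): this is the whole residue, shared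
with route WeilParity; a proof `… : Theses.WeilParity.NoParityCrossing` of item 18085 discharges it by
`Iff.rfl`. -/
theorem stub_noParityCrossing :
    ∀ a : ℝ, Real.log 3 / 2 < a → weilEvenGroundEnergy a ≠ weilOddGroundEnergy a := by
  intro a ha
  rcases le_or_gt a (63 / 100) with hle | hlt
  · -- two-prime cells E, F (v7): the C–vS clause holds at `a`, hence the strict order `ε_ev < ε_od`
    have ha0 : 0 < a := lt_trans (by positivity) ha
    exact ne_of_lt
      ((Summit.RiemannHypothesis.RiemannHypothesis.Theorems.EvenWinsBeyondArch.weilWindowSimpleEven_iff_weilEvenGroundEnergy_lt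
        ha0).1 (stub_cellsEF a ha hle))
  · exact stub_noParityCrossing_beyondF a hlt

/-- **STUB (BRIDGE) — ORDER beyond the second prime from no parity tie (provable now; LANDED as
`Theorems.stub_oddSectorGapBeyond_of_noParityCrossing`).** No tie for `a > (log 3)/2` + the certified
strict order `ε_ev < ε_od` at the anchor `(log 3)/2` (this line's cells, `stub_firstPrimeWindows`) + the
landed RH-free sector continuity (`Theorems.stub_sectorContinuity`, Bombieri 2000 Thm 5 per sector) give
`ε_ev(a) < ε_od(a)` for every `a > (log 3)/2` by the intermediate value theorem
(`EvenWinsBeyondArch.weilEvenGroundEnergy_lt_weilOddGroundEnergy_of_anchor`), and a strict order is an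
odd-sector gap of size `ε_od − ε_ev` (`oddSectorGap_of_weilEvenGroundEnergy_lt`). -/
theorem stub_oddSectorGapBeyond_of_noParityCrossing :
    (∀ a : ℝ, Real.log 3 / 2 < a → weilEvenGroundEnergy a ≠ weilOddGroundEnergy a) →
    ∀ a : ℝ, Real.log 3 / 2 < a → ∃ δ : ℝ, 0 < δ ∧ ∀ g : ℝ → ℂ, IsWeilTest g →
      tsupport g ⊆ Icc (-a) a → ∫ t, ‖g t‖ ^ 2 = (1 : ℝ) → (∀ t, g (-t) = -g t) →
        weilGroundEnergy a + δ ≤ (weilQuadratic g).re :=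
  -- LANDED (lead c4, p156985): Theorems/WeilGroundStateGroundStateSimpleEvenOfNoParityCrossing.lean
  -- (with the calibration `GroundStateSimpleEven.groundStateSimpleEven_iff_noParityCrossing`)
  Summit.RiemannHypothesis.RiemannHypothesis.Theorems.stub_oddSectorGapBeyond_of_noParityCrossing

/-- **ORDER-BEYOND (v5 name, now DERIVED from NPC through the bridge).** At every window beyond the
second prime, `(log 3)/2 < a`, the odd sector is gapped. -/
theorem stub_oddSectorGap_beyond :
    ∀ a : ℝ, Real.log 3 / 2 < a → ∃ δ : ℝ, 0 < δ ∧ ∀ g : ℝ → ℂ, IsWeilTest g →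
      tsupport g ⊆ Icc (-a) a → ∫ t, ‖g t‖ ^ 2 = (1 : ℝ) → (∀ t, g (-t) = -g t) →
        weilGroundEnergy a + δ ≤ (weilQuadratic g).re :=
  stub_oddSectorGapBeyond_of_noParityCrossing stub_noParityCrossing

/-! #### v5 worker stubs (generic analysis; all provable now) -/

/-- **STUB (RHO) — polynomial majorant of the archimedean jump density (provable now).**
`t ρ(t) = (1/2) e^{t/2} (t / sinh t)`; `e^{t/2} ≤ Σ_{k≤12} (t/2)^k/k! + 2 (t/2)^{13}/13!` on
`0 ≤ t/2 ≤ 1` (`Real.exp_bound`), and `t / sinh t ≤ S₁₂(t)` (the degree-12 partial sum of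
`t/sinh t = Σ (2 − 2^{2n}) B_{2n} t^{2n}/(2n)!`, ending with a positive term) because
`S₁₂(t) · (t + t³/3! + … + t¹⁵/15!) − t` is a polynomial with non-negative coefficients
(`8191 t¹⁵/37362124800 + …`, check by `ring`) and `sinh t ≥ t + t³/3! + … + t¹⁵/15!` (odd power
series with positive terms, `Real.hasSum_sinh`-type expansion or fifteen integrations of `cosh ≥ 1`).
Uniform error of the majorant `≤ 6.5·10⁻⁷` at `t = 11/10`. -/
theorem stub_rhoMajorant :
    ∀ t : ℝ, 0 < t → t ≤ 11 / 10 →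
      t * weilArchDensity t ≤
        1 / 2 * (1 + t / 2 + t ^ 2 / 8 + t ^ 3 / 48 + t ^ 4 / 384 + t ^ 5 / 3840 + t ^ 6 / 46080 + t ^ 7 / 645120 + t ^ 8 / 10321920 + t ^ 9 / 185794560 + t ^ 10 / 3715891200 + t ^ 11 / 81749606400 + t ^ 12 / 1961990553600 + t ^ 13 / 25505877196800) *
          (1 - t ^ 2 / 6 + 7 * t ^ 4 / 360 - 31 * t ^ 6 / 15120 + 127 * t ^ 8 / 604800 - 73 * t ^ 10 / 3421440 + 1414477 * t ^ 12 / 653837184000) := by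
  exact Summit.RiemannHypothesis.RiemannHypothesis.Theorems.stub_rhoMajorant

/-- **STUB (KILL) — the killing integral (provable now).**
`∫₀^∞ (e^{t/2} − 1)/(2 sinh t) dt = π/4 + (log 2)/2` (`= Σ_k (1/(2k+1/2) − 1/(2k+1))
= 2 Σ_k (1/(4k+1) − 1/(4k+2)) = (ψ(1/2) − ψ(1/4))/2`; Leibniz `Σ (−1)^k/(2k+1) = π/4` and the
alternating harmonic series `log 2`); only the lower bound to `10⁻⁷` is consumed (any route: the exact
value, or `K` terms of the expansion `Σ_k (e^{−(2k+1/2)t} − e^{−(2k+1)t})` of the tree's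
`mk_partial_sum_add_tail_le_weilKillingDensity` with a second-order tail estimate). -/
theorem stub_killingIntegral :
    (Real.pi / 4 + Real.log 2 / 2 - 1 / 10 ^ 7 : ℝ) ≤
      ∫ t in Ioi (0 : ℝ), (Real.exp (t / 2) - 1) / (2 * Real.sinh t) := by
  exact Summit.RiemannHypothesis.RiemannHypothesis.Theorems.stub_killingIntegral

/-- **STUB (MKFP) — window bookkeeping on the first-prime range (provable now).** For
`(log 2)/2 < b ≤ (log 3)/2` exactly one prime power enters the window: `weilPrimeIndex b` carries
`Λ(n) n^{-1/2} = 0` except at `n = 2`, where it is `log 2/√2`.  Hence the killing constant is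
`M_b = 2 (log 2/√2) + 2 ∫₀^∞ (e^{t/2} − 1)/(2 sinh t) dt + log 4π + γ` and the Dirichlet energy is
`𝓔_b(g) = (log 2/√2) D_{log 2}(g) + ∫_{(0,∞)} ρ D_t(g)` (`mem_weilPrimeIndex`,
`ArithmeticFunction.vonMangoldt_apply_prime`, `Nat.Prime` of `2`, `Λ 0 = Λ 1 = 0`, `log 3 ≤ 2b`
excludes `n = 3`; template `par_weilMarkovConstant_eq` of `…StubParabolaRayleigh.lean`). -/
theorem stub_markovFirstPrime :
    ∀ b : ℝ, Real.log 2 / 2 < b → b ≤ Real.log 3 / 2 →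
      weilMarkovConstant b =
          2 * (Real.log 2 / Real.sqrt 2) +
            2 * (∫ t in Ioi (0 : ℝ), (Real.exp (t / 2) - 1) / (2 * Real.sinh t)) +
            (Real.log (4 * Real.pi) + Real.eulerMascheroniConstant) ∧
      ∀ g : ℝ → ℂ, weilDirichletEnergy b g =
          Real.log 2 / Real.sqrt 2 * weilIncrement g (Real.log 2) +
            ∫ t in Ioi (0 : ℝ), weilArchDensity t * weilIncrement g t := by
  exact Summit.RiemannHypothesis.RiemannHypothesis.Theorems.stub_markovFirstPrime

/-- **STUB (TAILS) — the tail of the jump density at the four left end points (provable now).**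
`∫_{2b}^∞ ρ = π/2 − arctan(e^b) + (1/2) log((e^b + 1)/(e^b − 1))` (landed `stub_archTail`); at
`b ∈ {11/32, 2/5, 23/50, 51/100}` the values are `1.5021951369…, 1.4018516952…, 1.3066525538…,
1.2347056993…`; certified to `2·10⁻⁷` (bounds for `e^b` from `Real.exp_bound`, `arctan y =
π/4 + arctan((y−1)/(y+1))` with `arctan w ≥ w − w³/3 + w⁵/5 − w⁷/7 − …` by integrating
`1/(1+s²) ≥ 1 − s² + s⁴ − … − s^{4k+2}`, `log` through `Real.abs_log_sub_add_sum_range_le` /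
`Real.log_two_lt_d9`, `Real.pi_lt_d6`-family). -/
theorem stub_archTailAt :
    (∫ t in Ioi (2 * (11 / 32 : ℝ)), weilArchDensity t ≤ 1.502195337) ∧
      (∫ t in Ioi (2 * (2 / 5 : ℝ)), weilArchDensity t ≤ 1.401851896) ∧
      (∫ t in Ioi (2 * (23 / 50 : ℝ)), weilArchDensity t ≤ 1.306652754) ∧
      (∫ t in Ioi (2 * (51 / 100 : ℝ)), weilArchDensity t ≤ 1.234705900) := by
  exact Summit.RiemannHypothesis.RiemannHypothesis.Theorems.stub_archTailAt

/-- **STUB (COSH) — two-sided polynomial bounds for `cosh(x/2)` on `|x| ≤ 11/10` (provable now).**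
Lower: the partial sum `Σ_{m≤6} (x/2)^{2m}/(2m)!` (all terms of the even series are non-negative);
upper: the remainder `Σ_{m≥7} y^{2m}/(2m)! ≤ (y^{14}/14!) cosh y ≤ 2 y^{14}/14!`, `y = x/2`. -/
theorem stub_coshHalfBounds :
    ∀ x : ℝ, |x| ≤ 11 / 10 →
      1 + x ^ 2 / 8 + x ^ 4 / 384 + x ^ 6 / 46080 + x ^ 8 / 10321920 + x ^ 10 / 3715891200 +
            x ^ 12 / 1961990553600 ≤ Real.cosh (x / 2) ∧
        Real.cosh (x / 2) ≤
          1 + x ^ 2 / 8 + x ^ 4 / 384 + x ^ 6 / 46080 + x ^ 8 / 10321920 + x ^ 10 / 3715891200 +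
              x ^ 12 / 1961990553600 + 2 * x ^ 14 / 1428329123020800 := by
  exact Summit.RiemannHypothesis.RiemannHypothesis.Theorems.stub_coshHalfBounds

/-- **STUB (INC) — increments of a windowed profile (provable now; generic measure theory).** For a
continuous profile `p` and the windowed function `f = 1_{[-b,b]} · p` (real, viewed in `ℂ`):
`D_t(f) = ∫_{-b}^{-b+t} p² + ∫_{b-t}^{b} p² + ∫_{-b}^{b-t} (p(x+t) − p(x))²` for `0 ≤ t ≤ 2b`
(split `ℝ` at `-b-t, -b, b-t, b`), `D_t(f) = 2 ∫_{-b}^{b} p²` for `t ≥ 2b` (a.e.-disjoint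
translates), `‖f‖₂² = ∫_{-b}^{b} p²`, `f ∈ L²`, and `f = 0` off the window. -/
theorem stub_incrementSplit :
    ∀ (p : ℝ → ℝ) (b : ℝ), Continuous p → 0 < b →
      (∀ t : ℝ, 0 ≤ t → t ≤ 2 * b →
        weilIncrement (fun x : ℝ ↦ (((Icc (-b) b).indicator p x : ℝ) : ℂ)) t =
          (∫ x in (-b)..(-b + t), p x ^ 2) + (∫ x in (b - t)..b, p x ^ 2) +
            ∫ x in (-b)..(b - t), (p (x + t) - p x) ^ 2) ∧
      (∀ t : ℝ, 2 * b ≤ t →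
        weilIncrement (fun x : ℝ ↦ (((Icc (-b) b).indicator p x : ℝ) : ℂ)) t =
          2 * ∫ x in (-b)..b, p x ^ 2) ∧
      (∫ x : ℝ, ‖(((Icc (-b) b).indicator p x : ℝ) : ℂ)‖ ^ 2 = ∫ x in (-b)..b, p x ^ 2) ∧
      MemLp (fun x : ℝ ↦ (((Icc (-b) b).indicator p x : ℝ) : ℂ)) 2 volume ∧
      (∀ᵐ x : ℝ, x ∉ Icc (-b) b → (((Icc (-b) b).indicator p x : ℝ) : ℂ) = 0) := by
  exact Summit.RiemannHypothesis.RiemannHypothesis.Theorems.stub_incrementSplit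

/-- **STUB (OMS) — soundness of the ODD-SECTOR MARGIN certificate (provable now; the soundness proof
of `WeilCert3.weilFirstPrimeQuadratic_nonneg_of_check`, `WeilFirstPrimeCertificateZ.lean`, verbatim
up to its last step).** If a Stage-C-format certificate `c` passes the cells, scalar and moment checks
and its ODD block passes `checkBlockK` with a Bessel coefficient `κ'`, `0 ≤ κ' ≤ κ(c)`, then every ODD
test function `g` on `[-b, b]` has `(κ(c) − κ') ‖g‖₂² ≤ E₂(g)`.  Changes to the original proof: for odd
`g` the even moments `M_{2i} = ∫ g (x/a₀)^{2i}` vanish, so the even block contributes nothing to the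
algebraic core (`WeilCert.block_identityK` for `p = 1` only, `yVec M 0 = 0`, `uVec M (2i) = 0`);
`step3` gives `Σ P_r z + κ N₂ ≤ E₂`, Bessel is applied with the coefficient `κ' ≥ 0`, and the
difference `(κ − κ') N₂` is the margin. -/
theorem stub_oddMarginSound :
    ∀ (c : WeilCert3) (κ' : ℚ),
      checkCells₃ c.base.prec c.j c.base.wL c.base.T c.base.mwT c.cells = true →
      c.checkScalars = true → c.checkNu = true →
      c.base.checkBlockK c.nuTab κ' 1 = true → 0 ≤ κ' → κ' ≤ c.kappaQ →
      ∀ g : ℝ → ℂ, IsWeilTest g → tsupport g ⊆ Icc (-(c.b : ℝ)) c.b → (∀ x, g (-x) = -g x) →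
        ((c.kappaQ - κ' : ℚ) : ℝ) * weilNorm2Sq g ≤ weilFirstPrimeQuadratic g := by
  exact Summit.RiemannHypothesis.RiemannHypothesis.Theorems.stub_oddMarginSound

/-- **STUB (NUT) — transfer of the kernel-checked moment table of `weilCert3C` to another `a₀`
(provable now; rational arithmetic).** The moments of the Stage-C minorant scale like `a₀^q`:
`c.nuQ q = (c.base.a0 / (563/1024))^q · weilCert3C.nuQ q` when `c` reuses the level and the cells of
`weilCert3C`; so the claimed entry `ν̃'_q` of `c` is within `2^{-pnu(c)}` of `nuScale · c.nuQ q` as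
soon as `|ν̃'_q − r^q ν̃_q| + r^q 2^{-64} ≤ 2^{-pnu(c)}`, `r = a₀(c)·1024/563`, `ν̃_q` the Stage-C entry
(`weilCert3C.checkNuAt q`, `pnu = 64`) — a test on literals only. -/
theorem stub_checkNuTransfer :
    ∀ (c : WeilCert3) (q : ℕ), c.cells = weilCert3C.cells → c.base.wL = weilCert3C.base.wL →
      weilCert3C.checkNuAt q = true →
      |getV c.nuData q - (c.base.a0 / (563 / 1024)) ^ q * getV weilCert3CNuData q| +
          (c.base.a0 / (563 / 1024)) ^ q * (1 / 2 ^ 64) ≤ 1 / 2 ^ c.pnu →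
      0 ≤ c.base.a0 →
      c.checkNuAt q = true := by
  exact Summit.RiemannHypothesis.RiemannHypothesis.Theorems.stub_checkNuTransfer

/-! #### v5 lead stubs (generated certified evaluations; constants provisional until generated) -/

/-- **STUB (UA) — even upper bound at `b = 11/32`** (Rayleigh–Ritz, degree-4 even polynomial ×
indicator — the parabola `1 − (32x/11)²`; no prime enters, `11/32 < (log 2)/2`; true `e1 = 1.434e-3`,
certified `0.0052661`). -/
theorem stub_trialUpperA : weilGroundEnergy (11 / 32) ≤ 53 / 10000 := by
  exact Summit.RiemannHypothesis.RiemannHypothesis.Theorems.stub_trialUpperA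

/-- **STUB (UB) — even upper bound at `b = 2/5`** (degree-4 even polynomial × indicator, with the
prime-2 increment; true `e1 = 1.818e-4`, certified `2.4869e-4`). -/
theorem stub_trialUpperB : weilGroundEnergy (2 / 5) ≤ 3 / 10000 := by
  exact Summit.RiemannHypothesis.RiemannHypothesis.Theorems.stub_trialUpperB

/-- **STUB (UC) — even upper bound at `b = 23/50`** (degree-6; true `e1 = 9.30e-6`, certified `1.4325e-5`). -/
theorem stub_trialUpperC : weilGroundEnergy (23 / 50) ≤ 15 / 1000000 := by
  exact Summit.RiemannHypothesis.RiemannHypothesis.Theorems.stub_trialUpperC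

/-- **STUB (UD) — even upper bound at `b = 51/100`** (degree-8; true `e1 = 5.67e-7`, certified `3.3113e-6`). -/
theorem stub_trialUpperD : weilGroundEnergy (51 / 100) ≤ 17 / 5000000 := by
  exact Summit.RiemannHypothesis.RiemannHypothesis.Theorems.stub_trialUpperD

/-- **STUB (LA) — odd lower bound at `c = 2/5`** (odd-margin certificate A at `a₀ = 2/5`,
`κ − κ' = 1.0925e-2`; true `o1 = 1.474e-2`). -/
theorem stub_oddLowerA :
    ∀ g : ℝ → ℂ, IsWeilTest g → tsupport g ⊆ Icc (-(2 / 5 : ℝ)) (2 / 5) →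
      ∫ x, ‖g x‖ ^ 2 = (1 : ℝ) → (∀ x, g (-x) = -g x) → (1 / 100 : ℝ) ≤ (weilQuadratic g).re := by
  exact Summit.RiemannHypothesis.RiemannHypothesis.Theorems.stub_oddLowerA

/-- **STUB (LB) — odd lower bound at `c = 23/50`** (certificate B at `a₀ = 23/50`, `κ − κ' = 1.0546e-3`;
true `o1 = 1.563e-3`). -/
theorem stub_oddLowerB :
    ∀ g : ℝ → ℂ, IsWeilTest g → tsupport g ⊆ Icc (-(23 / 50 : ℝ)) (23 / 50) →
      ∫ x, ‖g x‖ ^ 2 = (1 : ℝ) → (∀ x, g (-x) = -g x) → (1 / 1000 : ℝ) ≤ (weilQuadratic g).re := by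
  exact Summit.RiemannHypothesis.RiemannHypothesis.Theorems.stub_oddLowerB

/-- **STUB (LC) — odd lower bound at `c = 51/100`** (certificate C at `a₀ = 51/100`, `κ − κ' = 6.596e-5`;
true `o1 = 1.096e-4`). -/
theorem stub_oddLowerC :
    ∀ g : ℝ → ℂ, IsWeilTest g → tsupport g ⊆ Icc (-(51 / 100 : ℝ)) (51 / 100) →
      ∫ x, ‖g x‖ ^ 2 = (1 : ℝ) → (∀ x, g (-x) = -g x) → (6 / 100000 : ℝ) ≤ (weilQuadratic g).re := by
  exact Summit.RiemannHypothesis.RiemannHypothesis.Theorems.stub_oddLowerC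

/-- **STUB (LD) — odd lower bound at `c = (log 3)/2`** (certificate at `a₀ = 563/1024 ≥ (log 3)/2`
reusing `weilCert3C`'s moment table verbatim, `κ − κ' = 6.4896e-6`; `E₂ = Re Q` on `C((log 3)/2)`;
true `o1 = 1.508e-5`). -/
theorem stub_oddLowerD :
    ∀ g : ℝ → ℂ, IsWeilTest g → tsupport g ⊆ Icc (-(Real.log 3 / 2)) (Real.log 3 / 2) →
      ∫ x, ‖g x‖ ^ 2 = (1 : ℝ) → (∀ x, g (-x) = -g x) → (6 / 1000000 : ℝ) ≤ (weilQuadratic g).re := by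
  exact Summit.RiemannHypothesis.RiemannHypothesis.Theorems.stub_oddLowerD

/-- **STUB (FPW) — the crux on every first-prime window (lead; from UA–UD, LA–LD and the landed
cell transfer).** For `(log 2)/2 < a ≤ (log 3)/2`, `WeilWindowSimpleEven a`. -/
theorem stub_firstPrimeWindows :
    ∀ a : ℝ, Real.log 2 / 2 < a → a ≤ Real.log 3 / 2 → WeilWindowSimpleEven a :=
  -- LANDED (lead c3, p154633): Theorems/WeilGroundStateGroundStateSimpleEvenFirstPrimeWindows.lean
  -- (four cells of `weilWindowSimpleEven_on_cell_of_le` fed by UA–UD and LA–LD; with the corollary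
  -- `weilWindowSimpleEven_of_le_log_three_half` — the crux on EVERY window `0 < a ≤ (log 3)/2`)
  Summit.RiemannHypothesis.RiemannHypothesis.Theorems.stub_firstPrimeWindows

/-- **STUB ORDER-LARGE (v3 name, now DERIVED): ORDER beyond the first prime** = FPW on
`((log 2)/2, (log 3)/2]` (via `weilWindowSimpleEven_iff_oddSectorGap`) + ORDER-BEYOND. -/
theorem stub_oddSectorGap_large :
    ∀ a : ℝ, Real.log 2 / 2 < a → ∃ δ : ℝ, 0 < δ ∧ ∀ g : ℝ → ℂ, IsWeilTest g →
      tsupport g ⊆ Icc (-a) a → ∫ t, ‖g t‖ ^ 2 = (1 : ℝ) → (∀ t, g (-t) = -g t) →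
        weilGroundEnergy a + δ ≤ (weilQuadratic g).re := by
  intro a ha
  rcases le_or_gt a (Real.log 3 / 2) with hle | hlt
  · have ha0 : 0 < a := lt_trans (by positivity) ha
    exact (Summit.RiemannHypothesis.RiemannHypothesis.Theorems.GroundStateSimpleEven.weilWindowSimpleEven_iff_oddSectorGap
      ha0).1 (stub_firstPrimeWindows a ha hle)
  · exact stub_oddSectorGap_beyond a hlt

/-- **STUB (ENV) — the odd Fourier envelope (provable now).** For an ODD test function `g` on
`[-a, a]`, `ĝ(1/2 + it) = i ∫ g(x) sin(tx) dx`, so by Cauchy–Schwarz on `[-a, a]`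
`|ĝ(1/2 + it)|² ≤ ‖g‖₂² ∫_{-a}^{a} sin²(tx) dx = ‖g‖₂² (a − sin(2at)/(2t))` (at `t = 0` both sides
read `0 ≤ a‖g‖₂²`, Lean's `x/0 = 0`). -/
theorem stub_oddFourierEnvelope :
    ∀ a : ℝ, 0 < a → ∀ g : ℝ → ℂ, IsWeilTest g → tsupport g ⊆ Icc (-a) a →
      (∀ x, g (-x) = -g x) → ∀ t : ℝ,
        ‖weilMellin g (1 / 2 + t * Complex.I)‖ ^ 2 ≤
          (a - Real.sin (2 * a * t) / (2 * t)) * ∫ x, ‖g x‖ ^ 2 := by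
  exact Summit.RiemannHypothesis.RiemannHypothesis.Theorems.stub_oddFourierEnvelope

/-- **STUB (TUB) — the bathtub principle with a variable cap (provable now; Lieb–Loss Thm 1.14).**
If `0 ≤ f ≤ F`, `m` is non-decreasing in `|t|` with `m(R) ≥ 0`, and the cap truncated to `[-R, R]`
carries no more mass than `f`, then `∫_{[-R,R]} F m ≤ ∫ f m` (move mass of `f` from `|t| > R`,
where `m ≥ m(R)`, into the deficit `F − f ≥ 0` on `[-R, R]`, where `m ≤ m(R)`). -/
theorem stub_bathtub :
    ∀ (f F m : ℝ → ℝ) (R : ℝ), 0 ≤ R → (∀ t, 0 ≤ f t) → (∀ t, f t ≤ F t) →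
      (∀ s t, |s| ≤ |t| → m s ≤ m t) → 0 ≤ m R →
      Integrable f → Integrable (fun t ↦ f t * m t) →
      IntegrableOn F (Icc (-R) R) → IntegrableOn (fun t ↦ F t * m t) (Icc (-R) R) →
      ∫ t in Icc (-R) R, F t ≤ ∫ t, f t →
        ∫ t in Icc (-R) R, F t * m t ≤ ∫ t, f t * m t := by
  exact Summit.RiemannHypothesis.RiemannHypothesis.Theorems.stub_bathtub

/-- **STUB (PSI) — Euler–Maclaurin minorant of the archimedean weight (provable now).**
`Re ψ(1/4 + it/2) = Re ψ(1/4) + Σ_m f_{l_m}(t)`, `f_l(t) = 2t²/(l(l² + t²))`, `l_m = 2m + 1/2`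
(`hasSum_digammaTerm`); the tail `Σ_{m ≥ 2}` of the CONVEX decreasing `m ↦ f_{l_m}(t)` is at
least `f_{9/2}(t)/2 + ∫_2^∞ f_{2x+1/2}(t) dx = t²/((9/2)(81/4 + t²)) + (1/2) log(1 + 4t²/81)`
(trapezoid inequality for convex functions; `∫ t²/(l(l²+t²)) dl = log l − (1/2)log(l² + t²)`).
Uniform error `≤ 0.017`. -/
theorem stub_reDigammaQuarter_ge :
    ∀ t : ℝ, Literature.Analysis.SpecialFunctions.reDigammaQuarter 0 +
        16 * t ^ 2 / (1 + 4 * t ^ 2) + 4 * t ^ 2 / (5 * (25 / 4 + t ^ 2)) +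
        2 * t ^ 2 / (9 * (81 / 4 + t ^ 2)) + Real.log (1 + 4 * t ^ 2 / 81) / 2 ≤
      Literature.Analysis.SpecialFunctions.reDigammaQuarter t := by
  exact Summit.RiemannHypothesis.RiemannHypothesis.Theorems.stub_reDigammaQuarter_ge

/-- **STUB (SIN) — two Taylor bounds for the sine on `[0, ∞)` (provable now).**
`sin x ≤ x − x³/6 + x⁵/120` and `x − x³/6 + x⁵/120 − x⁷/5040 ≤ sin x` for `x ≥ 0` (integrate
`cos ≤ 1` seven times; Mathlib has the orders `≤ 3`: `Real.sin_le`, `Real.one_sub_sq_div_two_le_cos`,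
`Real.sin_ge_sub_cube`). -/
theorem stub_sinTaylor :
    ∀ x : ℝ, 0 ≤ x →
      Real.sin x ≤ x - x ^ 3 / 6 + x ^ 5 / 120 ∧
        x - x ^ 3 / 6 + x ^ 5 / 120 - x ^ 7 / 5040 ≤ Real.sin x := by
  exact Summit.RiemannHypothesis.RiemannHypothesis.Theorems.stub_sinTaylor

/-- **STUB (LOG) — decimal brackets for `log 3`, `log 5`, `log 7`, `log π` (provable now).**
From `log 2` (Mathlib `Real.log_two_gt_d9` / `_lt_d9`), `π` (Mathlib `Real.pi_gt_d20` family) and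
the artanh series `Real.hasSum_log_sub_log_of_abs_lt_one` at `x = 1/5, 1/9, 1/15, (p−3)/(p+3)`:
`log 3 = log 2 + log(3/2)`, `log 5 = 2 log 2 + log(5/4)`, `log 7 = 3 log 2 − log(8/7)`,
`log π ≥ log 3 + log(p/3)` for a rational `p ≤ π`. -/
theorem stub_logAtoms :
    (1.098612288 : ℝ) ≤ Real.log 3 ∧ Real.log 3 ≤ 1.098612289 ∧
      (1.609437912 : ℝ) ≤ Real.log 5 ∧ Real.log 5 ≤ 1.609437913 ∧
      (1.945910149 : ℝ) ≤ Real.log 7 ∧ Real.log 7 ≤ 1.945910150 ∧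
      (1.144729885 : ℝ) ≤ Real.log Real.pi := by
  exact Summit.RiemannHypothesis.RiemannHypothesis.Theorems.stub_logAtoms

/-- **STUB (TAIL) — the tail of the archimedean jump density in closed form (provable now).**
`ρ(t) = e^{t/2}/(2 sinh t) = y³/(y⁴ − 1)`, `y = e^{t/2}`, has the primitive
`(1/2) log((e^{t/2} − 1)/(e^{t/2} + 1)) + arctan(e^{t/2})`, which tends to `π/2` at `+∞`; hence
`∫_{2b}^∞ ρ = π/2 − arctan(e^b) + (1/2) log((e^b + 1)/(e^b − 1))` for `b > 0`
(`MeasureTheory.integral_Ioi_of_hasDerivAt_of_tendsto`; integrability: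
`integrableOn_weilArchDensity_Ioi`). -/
theorem stub_archTail :
    ∀ b : ℝ, 0 < b → IntegrableOn weilArchDensity (Ioi (2 * b)) ∧
      ∫ t in Ioi (2 * b), weilArchDensity t =
        Real.pi / 2 - Real.arctan (Real.exp b) +
          Real.log ((Real.exp b + 1) / (Real.exp b - 1)) / 2 := by
  exact Summit.RiemannHypothesis.RiemannHypothesis.Theorems.stub_archTail

/-- **STUB (TAILBD) — elementary upper bound for the tail (provable now).** For `0 < b ≤ 1`:
`π/2 − arctan(e^b) + (1/2)log((e^b+1)/(e^b−1)) ≤ π/4 + (log 2)/2 − (log b)/2 − b/2 + b²/24 + b³/12`,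
from `arctan(e^b) = π/4 + arctan(tanh(b/2))`, `arctan y ≥ y − y³/3`, `tanh x ≥ x − x³/3`
(`x = b/2`), and `(e^b+1)/(e^b−1) = coth(b/2) ≤ (2/b) e^{b²/12}` (i.e. `x coth x ≤ 1 + x²/3 ≤ e^{x²/3}`,
`x cosh x ≤ (1 + x²/3) sinh x` by one differentiation). Slack `< 10⁻⁴` for `b ≤ 0.35`. -/
theorem stub_archTailBound :
    ∀ b : ℝ, 0 < b → b ≤ 1 →
      Real.pi / 2 - Real.arctan (Real.exp b) +
          Real.log ((Real.exp b + 1) / (Real.exp b - 1)) / 2 ≤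
        Real.pi / 4 + Real.log 2 / 2 - Real.log b / 2 - b / 2 + b ^ 2 / 24 + b ^ 3 / 12 := by
  exact Summit.RiemannHypothesis.RiemannHypothesis.Theorems.stub_archTailBound

/-- **STUB (PAR1) — the parabolic bump `h_b(x) = (1 − x²/b²)⁺`: norm, increments, inner energy
(provable now; the window-`b` rescaling `h_b(x) = trialFun (x/(3b))` of the bump of
`…ArchimedeanWindowSimpleEvenTrial1–3.lean`).** `‖h_b‖₂² = 16b/15`; `D_t(h_b) = b·D₁(t/b)` with
`D₁(s) = 8s²/3 − 4s³/3 + s⁵/15` on `[0, 2]` and `= 32/15` beyond (`weilIncrement_trialFun_of_le/ge`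
rescaled), so `D_t(h_b) = 32b/15 = 2‖h_b‖₂²` for `t ≥ 2b`; `t ↦ ρ(t) D_t(h_b)` is integrable on
`(0, ∞)`; and with `ρ(t) ≤ 1/(2t) + 1/4` (i.e. `(2 + t)(e^{t/2} − e^{−3t/2}) ≥ 4t`, three
differentiations) `∫_{(0,2b]} ρ D_t(h_b) ≤ b ∫₀² (1/(2s) + b/4) D₁(s) ds = b (248/225 + (28/45) b)`. -/
theorem stub_parabolaIncrementEnergy :
    ∀ b : ℝ, 0 < b →
      (∫ x : ℝ, ‖(((max (1 - (x / b) ^ 2) 0 : ℝ)) : ℂ)‖ ^ 2 = 16 * b / 15) ∧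
      (∀ t : ℝ, 2 * b ≤ t →
        weilIncrement (fun x : ℝ ↦ (((max (1 - (x / b) ^ 2) 0 : ℝ)) : ℂ)) t = 32 * b / 15) ∧
      IntegrableOn (fun t : ℝ ↦ weilArchDensity t *
        weilIncrement (fun x : ℝ ↦ (((max (1 - (x / b) ^ 2) 0 : ℝ)) : ℂ)) t) (Ioi 0) ∧
      ∫ t in Ioc 0 (2 * b), weilArchDensity t *
          weilIncrement (fun x : ℝ ↦ (((max (1 - (x / b) ^ 2) 0 : ℝ)) : ℂ)) t ≤
        b * (248 / 225 + 28 / 45 * b) := by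
  exact Summit.RiemannHypothesis.RiemannHypothesis.Theorems.stub_parabolaIncrementEnergy

/-- **STUB (PAR2) — Rayleigh quotient of the parabolic bump (provable now; assembly on top of the
conclusions of PAR1 and the integrability half of TAIL, taken as hypotheses).** For
`0 < b ≤ (log 2)/2` no prime enters (`weilPrimeIndex b` carries `Λ = 0`, `M_b = M_{(log 2)/2}`,
cf. `weilMarkovConstant_third_eq`), so `𝓔_b(h_b) = ∫_{(0,2b]} ρ D + (32b/15) ∫_{(2b,∞)} ρ`; the
form-domain Rayleigh bound `stub_formDomainPos` (`…WindowLipschitzStubFormDomainPos.lean`) gives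
`(M_b + ε(b)) ‖h_b‖₂² ≤ P(h_b) + 𝓔_b(h_b)` with
`P(h_b) ≤ 2 (∫ h_b cosh(x/2))² = 2 (8/b²)² (2b cosh(b/2) − 4 sinh(b/2))²`
(primitive `2(1 − x²/b²) sinh(x/2) + (8x/b²) cosh(x/2) − (16/b²) sinh(x/2)`); divide by `16b/15`. -/
theorem stub_parabolaRayleigh :
    ∀ b : ℝ, 0 < b → b ≤ Real.log 2 / 2 →
      (∫ x : ℝ, ‖(((max (1 - (x / b) ^ 2) 0 : ℝ)) : ℂ)‖ ^ 2 = 16 * b / 15) →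
      (∀ t : ℝ, 2 * b ≤ t →
        weilIncrement (fun x : ℝ ↦ (((max (1 - (x / b) ^ 2) 0 : ℝ)) : ℂ)) t = 32 * b / 15) →
      IntegrableOn (fun t : ℝ ↦ weilArchDensity t *
        weilIncrement (fun x : ℝ ↦ (((max (1 - (x / b) ^ 2) 0 : ℝ)) : ℂ)) t) (Ioi 0) →
      (∫ t in Ioc 0 (2 * b), weilArchDensity t *
          weilIncrement (fun x : ℝ ↦ (((max (1 - (x / b) ^ 2) 0 : ℝ)) : ℂ)) t ≤
        b * (248 / 225 + 28 / 45 * b)) →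
      IntegrableOn weilArchDensity (Ioi (2 * b)) →
      weilGroundEnergy b ≤
        120 / b ^ 5 * (2 * b * Real.cosh (b / 2) - 4 * Real.sinh (b / 2)) ^ 2 +
          15 / 16 * (248 / 225 + 28 / 45 * b) +
          2 * (∫ t in Ioi (2 * b), weilArchDensity t) - weilMarkovConstant (Real.log 2 / 2) := by
  exact Summit.RiemannHypothesis.RiemannHypothesis.Theorems.stub_parabolaRayleigh

/-- **STUB (MK) — a sharper decimal lower bound for the killing constant (provable now; optional
sharpening of `weilMarkovConstant_log_two_half_ge : 5.367 ≤ M`, `…Trial4.lean`, more terms of the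
same series; `M = π/2 + 3 log 2 + log π + γ = 5.37218…`).** -/
theorem stub_markovConstant_ge :
    (5.3716 : ℝ) ≤ weilMarkovConstant (Real.log 2 / 2) := by
  exact Summit.RiemannHypothesis.RiemannHypothesis.Theorems.stub_markovConstant_ge

/-! ### v3 wave 2 (lead c2): the generic bathtub instantiation and the elementary pieces of the
certified evaluation (all provable now). -/

/-- **STUB (GEN) — the odd lower bound, generic in the envelope (provable now; from ENV, TUB, PSI
and the tree's Fourier representation).** For `0 < c ≤ (log 2)/2`, a measurable bounded cap `E`
dominating the odd envelope profile `1 − sin(2u)/(2u)` on `u ≥ 0`, and a radius `u₁ ≥ 11c` at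
which the truncated cap carries mass `≤ π`: every `L²`-normalised ODD window-`c` test function has
`Re Q(g) ≥ −2(sinh c − c) − log π + (1/π) ∫₀^{u₁} E(u) m(u/c) du`, where `m` is the Euler–Maclaurin
minorant of `Re ψ(1/4 + it/2)` of stub PSI.  Route: `Re Q = weilArchQuadratic = P − log π ‖g‖² +
(1/2π) ∫ |ĝ(1/2+it)|² Re ψ(1/4+it/2)` (`weilQuadratic_re_eq_weilArchQuadratic`),
`P ≥ −2(sinh c − c)‖g‖²` (`Yoshida1992_polar_lower_bound`), minorant principle
(`integral_norm_sq_weilMellin_mul_mono` with `σ = m`, quadratic growth, `stub_reDigammaQuarter_ge`),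
bathtub `stub_bathtub` with `f = |ĝ(1/2+it)|²`, `F(t) = c·E(c|t|)` (`f ≤ F` by
`stub_oddFourierEnvelope` and `hE`), `m` non-decreasing in `|t|`, `m(u₁/c) ≥ m(11) > 0`,
mass `∫_{[-R,R]} F = 2∫₀^{u₁} E ≤ 2π = ∫ f` (Plancherel `integral_norm_sq_weilMellin_half_line`),
`R = u₁/c`; finally `∫_{[-R,R]} F m = 2∫₀^{u₁} E(u) m(u/c) du` (even integrand, `u = ct`). -/
theorem stub_oddLowerGeneric :
    ∀ c : ℝ, 0 < c → c ≤ Real.log 2 / 2 → ∀ (E : ℝ → ℝ) (B u₁ : ℝ), Measurable E →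
      (∀ u, |E u| ≤ B) → (∀ u, 0 ≤ u → 1 - Real.sin (2 * u) / (2 * u) ≤ E u) → 11 * c ≤ u₁ →
      ∫ u in (0 : ℝ)..u₁, E u ≤ Real.pi →
      ∀ g : ℝ → ℂ, IsWeilTest g → tsupport g ⊆ Icc (-c) c → (∀ x, g (-x) = -g x) →
        ∫ x, ‖g x‖ ^ 2 = (1 : ℝ) →
        -(2 * (Real.sinh c - c)) - Real.log Real.pi +
          1 / Real.pi * ∫ u in (0 : ℝ)..u₁, E u *
            (Literature.Analysis.SpecialFunctions.reDigammaQuarter 0 +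
              16 * (u / c) ^ 2 / (1 + 4 * (u / c) ^ 2) +
              4 * (u / c) ^ 2 / (5 * (25 / 4 + (u / c) ^ 2)) +
              2 * (u / c) ^ 2 / (9 * (81 / 4 + (u / c) ^ 2)) +
              Real.log (1 + 4 * (u / c) ^ 2 / 81) / 2) ≤ (weilQuadratic g).re := by
  exact Summit.RiemannHypothesis.RiemannHypothesis.Theorems.stub_oddLowerGeneric

/-- **STUB (HYP) — hyperbolic Taylor bounds for the pole terms (provable now).** For `0 ≤ b ≤ 1`:
`0 ≤ 2b cosh(b/2) − 4 sinh(b/2) ≤ b³/6 + b⁵/200` (`= b³/6 + b⁵/240 + b⁷/26880 + …`; e.g.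
`x cosh x − sinh x` has derivative `x sinh x`, and `sinh x ≤ x + x³/6 + x⁵/100` on `[0, 1/2]`) and
`sinh b − b ≤ b³/6 + b⁵/100` (numerically: slack ≥ 8·10⁻⁴ at b = 1, true on all of `[0,1]`).
Mathlib: `Real.sinh_lt_cosh`, `Real.self_le_sinh_iff`, `Real.cosh_le_exp_half_sq`, power series
`Real.hasSum_sinh/cosh`… any elementary route. -/
theorem stub_hyperbolicBounds :
    ∀ b : ℝ, 0 ≤ b → b ≤ 1 →
      0 ≤ 2 * b * Real.cosh (b / 2) - 4 * Real.sinh (b / 2) ∧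
        2 * b * Real.cosh (b / 2) - 4 * Real.sinh (b / 2) ≤ b ^ 3 / 6 + b ^ 5 / 200 ∧
        Real.sinh b - b ≤ b ^ 3 / 6 + b ^ 5 / 100 := by
  exact Summit.RiemannHypothesis.RiemannHypothesis.Theorems.stub_hyperbolicBounds

/-- **STUB (ATAN) — arctangent enclosures and the Padé bound for `log(1+y)` (provable now).**
(i) `w − w³/3 ≤ arctan w ≤ w − w³/3 + w⁵/5` on `[0,1]` (derivatives against `1/(1+w²)`);
(ii) `arctan y = π/4 + arctan((y−1)/(y+1))` for `y > 0` (Mathlib `Real.arctan_add`/four-quadrant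
bookkeeping, `Real.arctan_one`); (iii) `2y/(2+y) ≤ log(1+y)` for `y ≥ 0` (derivative
`1/(1+y) − 4/(2+y)² = y²/((1+y)(2+y)²) ≥ 0`). -/
theorem stub_arctanLogBounds :
    (∀ w : ℝ, 0 ≤ w → w ≤ 1 →
        w - w ^ 3 / 3 ≤ Real.arctan w ∧ Real.arctan w ≤ w - w ^ 3 / 3 + w ^ 5 / 5) ∧
      (∀ y : ℝ, 0 < y → Real.arctan y = Real.pi / 4 + Real.arctan ((y - 1) / (y + 1))) ∧
      (∀ y : ℝ, 0 ≤ y → 2 * y / (2 + y) ≤ Real.log (1 + y)) := by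
  exact Summit.RiemannHypothesis.RiemannHypothesis.Theorems.stub_arctanLogBounds

/-- **STUB (PANELS) — recipes bounding the envelope profile `1 − sin(2u)/(2u)` on panels
(provable now; from `stub_sinTaylor` = `KLSNumerics.sin_le_taylor_five/taylor_seven_le_sin` and
Mathlib's `Real.sin_le`, `sin_pi_sub`, `sin_sub_two_pi`/periodicity, π bounds).** In order:
polynomial cap on `[0, 7/5]`; positive-sine panels below `π/2` (`sin ≥ sin x` on `[x, π−x]`);
negative-sine panels with `2u − π ∈ [0, x] ⊆ [0, π/2]`; negative-sine panels with
`2π − 2u ∈ [0, z] ⊆ [0, π/2]`; the trivial cap `1 + 1/(2a)`; the straddling cap (`sin y ≤ y`);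
`sin(2u) ≥ 0` for `2u ∈ [32/5, 47/5] ⊆ [2π, 3π]`; and the trivial global cap `2`. -/
theorem stub_sinPanels :
    (∀ u : ℝ, 0 < u → u ≤ 7 / 5 →
        1 - Real.sin (2 * u) / (2 * u) ≤ 2 / 3 * u ^ 2 - 2 / 15 * u ^ 4 + 4 / 315 * u ^ 6) ∧
      (∀ a b x u : ℝ, 0 < a → a ≤ u → u ≤ b → 0 ≤ x → x ≤ Real.pi / 2 → x ≤ 2 * a →
        2 * b ≤ Real.pi - x → 1 - Real.sin (2 * u) / (2 * u) ≤ 1 - (x - x ^ 3 / 6) / (2 * b)) ∧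
      (∀ a b x u : ℝ, 0 < a → a ≤ u → u ≤ b → Real.pi ≤ 2 * a → 2 * b - Real.pi ≤ x →
        x ≤ Real.pi / 2 →
          1 - Real.sin (2 * u) / (2 * u) ≤ 1 + (x - x ^ 3 / 6 + x ^ 5 / 120) / (2 * a)) ∧
      (∀ a b z u : ℝ, 0 < a → a ≤ u → u ≤ b → 3 * Real.pi / 2 ≤ 2 * a → 2 * b ≤ 2 * Real.pi →
        2 * Real.pi - 2 * a ≤ z → z ≤ Real.pi / 2 →
          1 - Real.sin (2 * u) / (2 * u) ≤ 1 + (z - z ^ 3 / 6 + z ^ 5 / 120) / (2 * a)) ∧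
      (∀ a u : ℝ, 0 < a → a ≤ u → 1 - Real.sin (2 * u) / (2 * u) ≤ 1 + 1 / (2 * a)) ∧
      (∀ a b x u : ℝ, 0 < a → a ≤ u → u ≤ b → 0 ≤ x → 2 * b - Real.pi ≤ x →
        1 - Real.sin (2 * u) / (2 * u) ≤ 1 + x / (2 * a)) ∧
      (∀ u : ℝ, 16 / 5 ≤ u → u ≤ 47 / 10 → 1 - Real.sin (2 * u) / (2 * u) ≤ 1) ∧
      (∀ u : ℝ, 0 < u → 1 - Real.sin (2 * u) / (2 * u) ≤ 2) := by
  exact Summit.RiemannHypothesis.RiemannHypothesis.Theorems.stub_sinPanels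

/-- **STUB (PIECES) — closed forms and monotone bounds for the piece integrals of the certified
evaluation (provable now; Mathlib `integral_log`, FTC `intervalIntegral.integral_eq_sub_of_hasDerivAt`,
`Real.hasDerivAt_arctan`, `intervalIntegral.integral_mono_on`).** (i) `∫_a^b log`; (ii)
`∫_ε^B u^k log u`; (iii) the small-`u` tail `∫₀^ε (poly cap)·log u ≥ −ε²/3` (`0 < ε ≤ 1`: the cap
is `≤ (2/3)u²` there and `log u ≥ 1 − 1/u`); (iv) `∫₀^B u^{2,4,6}/(A + u²)` through `arctan(B/r)`,
`r² = A`; (v) `(b−a)·C/(A+b²) ≤ ∫_a^b C/(A+u²) ≤ (b−a)·C/(A+a²)`. -/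
theorem stub_pieceIntegrals :
    (∀ a b : ℝ, 0 < a → a ≤ b →
        ∫ u in a..b, Real.log u = (b * Real.log b - b) - (a * Real.log a - a)) ∧
      (∀ ε B : ℝ, 0 < ε → ε ≤ B → ∀ k : ℕ,
        ∫ u in ε..B, u ^ k * Real.log u =
          (B ^ (k + 1) * Real.log B / (k + 1) - B ^ (k + 1) / (k + 1) ^ 2) -
            (ε ^ (k + 1) * Real.log ε / (k + 1) - ε ^ (k + 1) / (k + 1) ^ 2)) ∧
      (∀ ε : ℝ, 0 < ε → ε ≤ 1 →
        -(ε ^ 2 / 3) ≤ ∫ u in (0 : ℝ)..ε,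
          (2 / 3 * u ^ 2 - 2 / 15 * u ^ 4 + 4 / 315 * u ^ 6) * Real.log u) ∧
      (∀ A r B : ℝ, 0 < r → r ^ 2 = A → 0 ≤ B →
        (∫ u in (0 : ℝ)..B, u ^ 2 / (A + u ^ 2) = B - r * Real.arctan (B / r)) ∧
          (∫ u in (0 : ℝ)..B, u ^ 4 / (A + u ^ 2) =
            B ^ 3 / 3 - A * B + A * r * Real.arctan (B / r)) ∧
          (∫ u in (0 : ℝ)..B, u ^ 6 / (A + u ^ 2) =
            B ^ 5 / 5 - A * B ^ 3 / 3 + A ^ 2 * B - A ^ 2 * r * Real.arctan (B / r))) ∧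
      (∀ a b C A : ℝ, 0 ≤ a → a ≤ b → 0 < A → 0 ≤ C →
        (∫ u in a..b, C / (A + u ^ 2) ≤ (b - a) * (C / (A + a ^ 2))) ∧
          ((b - a) * (C / (A + b ^ 2)) ≤ ∫ u in a..b, C / (A + u ^ 2))) := by
  exact Summit.RiemannHypothesis.RiemannHypothesis.Theorems.stub_pieceIntegrals

/-- **STUB (ARCH) — the crux on every archimedean window (lead; from ENV, TUB, PSI, SIN, LOG, TAIL,
TAILBD, PAR1, PAR2, MK and the kernel-checked odd bound `1/20` at `(log 2)/2`).** For every
`0 < a ≤ (log 2)/2`, `WeilWindowSimpleEven a`.  Odd LOWER bound by the Fourier bathtub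
(`Re Q = P + (1/2π)∫|ĝ|² Re ψ(1/4+it/2) − log π‖g‖²`, envelope ENV, minorant PSI, TUB), even UPPER
bound by the parabola (PAR2 + TAILBD), explicit margin `> 0` on `(0, 7/25]`; the cell `[7/25, (log 2)/2]`
by `weilWindowSimpleEven_on_cell_of_le` with the certificate's odd bound. -/
theorem stub_archimedeanWindows :
    ∀ a : ℝ, 0 < a → a ≤ Real.log 2 / 2 → WeilWindowSimpleEven a := by
  exact Summit.RiemannHypothesis.RiemannHypothesis.Theorems.stub_archimedeanWindows

/-!
## Stubs (registered; v4) — the certified-evaluation chain behind ARCH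

Each is landed under `Theorems/WeilGroundStateGroundStateSimpleEven<Arch…>.lean` (`--supports`); the
statements are about the chosen cap `Classical.choose stub_archCapExists`.
-/

/-- Registered ARCH sub-goal `stub_archCapExists` (see the landed file for the documentation). -/
theorem stub_archCapExists :
    ∃ E : ℝ → ℝ,
      (∀ u : ℝ, u ≤ 0 → E u = 1) ∧
      (∀ u : ℝ, 0 < u → u ≤ 7 / 5 → E u = 2 / 3 * u ^ 2 - 2 / 15 * u ^ 4 + 4 / 315 * u ^ 6) ∧
      (∀ u : ℝ, (7 / 5) < u → u ≤ (3 / 2) → E u = (95297 / 100000)) ∧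
      (∀ u : ℝ, (3 / 2) < u → u ≤ (8 / 5) → E u = (101947 / 100000)) ∧
      (∀ u : ℝ, (8 / 5) < u → u ≤ (5 / 3) → E u = (26489 / 25000)) ∧
      (∀ u : ℝ, (5 / 3) < u → u ≤ (7 / 4) → E u = (27631 / 25000)) ∧
      (∀ u : ℝ, (7 / 4) < u → u ≤ (9 / 5) → E u = (28161 / 25000)) ∧
      (∀ u : ℝ, (9 / 5) < u → u ≤ (15 / 8) → E u = (115877 / 100000)) ∧
      (∀ u : ℝ, (15 / 8) < u → u ≤ (35 / 18) → E u = (189 / 160)) ∧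
      (∀ u : ℝ, (35 / 18) < u → u ≤ 2 → E u = (119463 / 100000)) ∧
      (∀ u : ℝ, 2 < u → u ≤ (25 / 12) → E u = (971 / 800)) ∧
      (∀ u : ℝ, (25 / 12) < u → u ≤ (21 / 10) → E u = (4837 / 4000)) ∧
      (∀ u : ℝ, (21 / 10) < u → u ≤ (35 / 16) → E u = (15311 / 12500)) ∧
      (∀ u : ℝ, (35 / 16) < u → u ≤ (9 / 4) → E u = (61191 / 50000)) ∧
      (∀ u : ℝ, (9 / 4) < u → u ≤ (7 / 3) → E u = (122223 / 100000)) ∧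
      (∀ u : ℝ, (7 / 3) < u → u ≤ (12 / 5) → E u = (121429 / 100000)) ∧
      (∀ u : ℝ, (12 / 5) < u → u ≤ (5 / 2) → E u = (120817 / 100000)) ∧
      (∀ u : ℝ, (5 / 2) < u → u ≤ (18 / 7) → E u = (119201 / 100000)) ∧
      (∀ u : ℝ, (18 / 7) < u → u ≤ (21 / 8) → E u = (117681 / 100000)) ∧
      (∀ u : ℝ, (21 / 8) < u → u ≤ (27 / 10) → E u = (58183 / 50000)) ∧
      (∀ u : ℝ, (27 / 10) < u → u ≤ (14 / 5) → E u = (14289 / 12500)) ∧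
      (∀ u : ℝ, (14 / 5) < u → u ≤ (35 / 12) → E u = (111273 / 100000)) ∧
      (∀ u : ℝ, (35 / 12) < u → u ≤ 3 → E u = (21491 / 20000)) ∧
      (∀ u : ℝ, 3 < u → u ≤ (25 / 8) → E u = (104657 / 100000)) ∧
      (∀ u : ℝ, (25 / 8) < u → u ≤ (392 / 125) → E u = (100531 / 100000)) ∧
      (∀ u : ℝ, (392 / 125) < u → u ≤ (16 / 5) → E u = (14493 / 12500)) ∧
      (∀ u : ℝ, 16 / 5 < u → u ≤ 47 / 10 → E u = 1) ∧
      (∀ u : ℝ, 47 / 10 < u → E u = 2) ∧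
      (Measurable E) := by
  exact Summit.RiemannHypothesis.RiemannHypothesis.Theorems.stub_archCapExists

/-- Registered ARCH sub-goal `stub_archLogBreakpoints` (see the landed file for the documentation). -/
theorem stub_archLogBreakpoints :
    (Real.log (4 : ℝ) = 2 * Real.log 2) ∧
      (Real.log (8 : ℝ) = 3 * Real.log 2) ∧
      (Real.log (9 : ℝ) = 2 * Real.log 3) ∧
      (Real.log (10 : ℝ) = Real.log 2 + Real.log 5) ∧
      (Real.log (12 : ℝ) = 2 * Real.log 2 + Real.log 3) ∧
      (Real.log (14 : ℝ) = Real.log 2 + Real.log 7) ∧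
      (Real.log (15 : ℝ) = Real.log 3 + Real.log 5) ∧
      (Real.log (16 : ℝ) = 4 * Real.log 2) ∧
      (Real.log (18 : ℝ) = Real.log 2 + 2 * Real.log 3) ∧
      (Real.log (21 : ℝ) = Real.log 3 + Real.log 7) ∧
      (Real.log (25 : ℝ) = 2 * Real.log 5) ∧
      (Real.log (27 : ℝ) = 3 * Real.log 3) ∧
      (Real.log (35 : ℝ) = Real.log 5 + Real.log 7) ∧
      (Real.log (100 : ℝ) = 2 * Real.log 2 + 2 * Real.log 5) ∧
      (Real.log (125 : ℝ) = 3 * Real.log 5) ∧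
      (Real.log (392 : ℝ) = 3 * Real.log 2 + 2 * Real.log 7) := by
  exact Summit.RiemannHypothesis.RiemannHypothesis.Theorems.stub_archLogBreakpoints

/-- Registered ARCH sub-goal `stub_archClosedForms` (see the landed file for the documentation). -/
theorem stub_archClosedForms :
    (∫ u in (1 / 100 : ℝ)..(7 / 5), (2 / 3 * u ^ 2 - 2 / 15 * u ^ 4 + 4 / 315 * u ^ 6) * Real.log u =
        ((1706768 / 3515625) * Real.log (7 / 5) + (-(1870036 / 10546875))) - ((12249853001 / 55125000000000000) * Real.log (1 / 100) + (-(85749382603 / 1157625000000000000)))) ∧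
      (∫ u in (0 : ℝ)..(7 / 5), (2 / 3 * u ^ 2 - 2 / 15 * u ^ 4 + 4 / 315 * u ^ 6) = (1706768 / 3515625)) ∧
      (∀ A r C B : ℝ, 0 < r → r ^ 2 = A → 0 ≤ B →
        ∫ u in (0 : ℝ)..B, (2 / 3 * u ^ 2 - 2 / 15 * u ^ 4 + 4 / 315 * u ^ 6) * (C / (A + u ^ 2)) =
          C * (2 / 3 * (B - r * Real.arctan (B / r))
            - 2 / 15 * (B ^ 3 / 3 - A * B + A * r * Real.arctan (B / r))
            + 4 / 315 * (B ^ 5 / 5 - A * B ^ 3 / 3 + A ^ 2 * B - A ^ 2 * r * Real.arctan (B / r)))) := by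
  exact Summit.RiemannHypothesis.RiemannHypothesis.Theorems.stub_archClosedForms

/-- Registered ARCH sub-goal `stub_archLorentzWindows` (see the landed file for the documentation). -/
theorem stub_archLorentzWindows :
    (∀ A₁ C₁ A₂ C₂ A₃ C₃ a b : ℝ, 0 < A₁ → 0 ≤ C₁ → 0 < A₂ → 0 ≤ C₂ → 0 < A₃ → 0 ≤ C₃ →
        0 ≤ a → a ≤ b →
        ∫ u in a..b, (C₁ / (A₁ + u ^ 2) + C₂ / (A₂ + u ^ 2) + C₃ / (A₃ + u ^ 2)) ≤
          (b - a) * (C₁ / (A₁ + a ^ 2) + C₂ / (A₂ + a ^ 2) + C₃ / (A₃ + a ^ 2))) ∧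
      (∀ A C a b : ℝ, 0 < A → 0 ≤ C → 0 ≤ a → a ≤ b →
        (b - a) * (C / (A + b ^ 2)) ≤ ∫ u in a..b, C / (A + u ^ 2)) := by
  exact Summit.RiemannHypothesis.RiemannHypothesis.Theorems.stub_archLorentzWindows

/-- Registered ARCH sub-goal `stub_archCapPieces` (see the landed file for the documentation). -/
theorem stub_archCapPieces :
    (∀ u : ℝ, 0 ≤ Classical.choose stub_archCapExists u ∧ Classical.choose stub_archCapExists u ≤ 2) ∧
      (∀ a b : ℝ, IntervalIntegrable (Classical.choose stub_archCapExists) volume a b) ∧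
      (∀ a b : ℝ, IntervalIntegrable (fun u : ℝ ↦ Classical.choose stub_archCapExists u * Real.log u) volume a b) := by
  exact Summit.RiemannHypothesis.RiemannHypothesis.Theorems.stub_archCapPieces

/-- Registered ARCH sub-goal `stub_archCapValidA` (see the landed file for the documentation). -/
theorem stub_archCapValidA :
    ∀ u : ℝ, 7 / 5 < u → u ≤ 35 / 16 → 1 - Real.sin (2 * u) / (2 * u) ≤ Classical.choose stub_archCapExists u := by
  exact Summit.RiemannHypothesis.RiemannHypothesis.Theorems.stub_archCapValidA

/-- Registered ARCH sub-goal `stub_archCapValid` (see the landed file for the documentation). -/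
theorem stub_archCapValid :
    ∀ u : ℝ, 0 ≤ u → 1 - Real.sin (2 * u) / (2 * u) ≤ Classical.choose stub_archCapExists u := by
  exact Summit.RiemannHypothesis.RiemannHypothesis.Theorems.stub_archCapValid

/-- Registered ARCH sub-goal `stub_archCapMass` (see the landed file for the documentation). -/
theorem stub_archCapMass :
    (∫ u in (0 : ℝ)..(16 / 5 + (Real.pi - (7972348261 / 3150000000))), Classical.choose stub_archCapExists u = Real.pi) ∧
      (16 / 5 : ℝ) < (16 / 5 + (Real.pi - (7972348261 / 3150000000))) ∧ (16 / 5 + (Real.pi - (7972348261 / 3150000000))) ≤ (47 / 10 : ℝ) := by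
  exact Summit.RiemannHypothesis.RiemannHypothesis.Theorems.stub_archCapMass

/-- Registered ARCH sub-goal `stub_archKlog` (see the landed file for the documentation). -/
theorem stub_archKlog :
    (588601 / 250000 : ℝ) ≤ ∫ u in (0 : ℝ)..(16 / 5 + (Real.pi - (7972348261 / 3150000000))), Classical.choose stub_archCapExists u * Real.log u := by
  exact Summit.RiemannHypothesis.RiemannHypothesis.Theorems.stub_archKlog

/-- Registered ARCH sub-goal `stub_archLorentzP1` (see the landed file for the documentation). -/
theorem stub_archLorentzP1 :
    (∫ u in (0 : ℝ)..(16 / 5 + (Real.pi - (7972348261 / 3150000000))), Classical.choose stub_archCapExists u * ((1 / 5) ^ 2 / ((1 / 5) ^ 2 / 4 + u ^ 2) + 5 * (1 / 5) ^ 2 / (25 * (1 / 5) ^ 2 / 4 + u ^ 2) + 9 * (1 / 5) ^ 2 / 2 / (81 * (1 / 5) ^ 2 / 4 + u ^ 2)) ≤ (91497 / 250000 : ℝ)) ∧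
      (∫ u in (0 : ℝ)..(16 / 5 + (Real.pi - (7972348261 / 3150000000))), Classical.choose stub_archCapExists u * ((1 / 4) ^ 2 / ((1 / 4) ^ 2 / 4 + u ^ 2) + 5 * (1 / 4) ^ 2 / (25 * (1 / 4) ^ 2 / 4 + u ^ 2) + 9 * (1 / 4) ^ 2 / 2 / (81 * (1 / 4) ^ 2 / 4 + u ^ 2)) ≤ (259349 / 500000 : ℝ)) := by
  exact Summit.RiemannHypothesis.RiemannHypothesis.Theorems.stub_archLorentzP1

/-- Registered ARCH sub-goal `stub_archLorentzP2` (see the landed file for the documentation). -/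
theorem stub_archLorentzP2 :
    (∫ u in (0 : ℝ)..(16 / 5 + (Real.pi - (7972348261 / 3150000000))), Classical.choose stub_archCapExists u * ((27 / 100) ^ 2 / ((27 / 100) ^ 2 / 4 + u ^ 2) + 5 * (27 / 100) ^ 2 / (25 * (27 / 100) ^ 2 / 4 + u ^ 2) + 9 * (27 / 100) ^ 2 / 2 / (81 * (27 / 100) ^ 2 / 4 + u ^ 2)) ≤ (582637 / 1000000 : ℝ)) ∧
      (∫ u in (0 : ℝ)..(16 / 5 + (Real.pi - (7972348261 / 3150000000))), Classical.choose stub_archCapExists u * ((7 / 25) ^ 2 / ((7 / 25) ^ 2 / 4 + u ^ 2) + 5 * (7 / 25) ^ 2 / (25 * (7 / 25) ^ 2 / 4 + u ^ 2) + 9 * (7 / 25) ^ 2 / 2 / (81 * (7 / 25) ^ 2 / 4 + u ^ 2)) ≤ (61507 / 100000 : ℝ)) := by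
  exact Summit.RiemannHypothesis.RiemannHypothesis.Theorems.stub_archLorentzP2

/-- Registered ARCH sub-goal `stub_archLorentzM` (see the landed file for the documentation). -/
theorem stub_archLorentzM :
    ((282349 / 1000000 : ℝ) ≤ ∫ u in (0 : ℝ)..(16 / 5 + (Real.pi - (7972348261 / 3150000000))), Classical.choose stub_archCapExists u * (9 * (1 / 5) ^ 2 / (9 * (1 / 5) ^ 2 + u ^ 2))) ∧
      ((395683 / 1000000 : ℝ) ≤ ∫ u in (0 : ℝ)..(16 / 5 + (Real.pi - (7972348261 / 3150000000))), Classical.choose stub_archCapExists u * (9 * (1 / 4) ^ 2 / (9 * (1 / 4) ^ 2 + u ^ 2))) ∧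
      ((55283 / 125000 : ℝ) ≤ ∫ u in (0 : ℝ)..(16 / 5 + (Real.pi - (7972348261 / 3150000000))), Classical.choose stub_archCapExists u * (9 * (27 / 100) ^ 2 / (9 * (27 / 100) ^ 2 + u ^ 2))) := by
  exact Summit.RiemannHypothesis.RiemannHypothesis.Theorems.stub_archLorentzM

/-- Registered ARCH sub-goal `stub_archOddLowerPrep` (see the landed file for the documentation). -/
theorem stub_archOddLowerPrep :
    (∀ c c₀ u : ℝ, 0 < c → c ≤ c₀ →
        c ^ 2 / (c ^ 2 / 4 + u ^ 2) + 5 * c ^ 2 / (25 * c ^ 2 / 4 + u ^ 2) + 9 * c ^ 2 / 2 / (81 * c ^ 2 / 4 + u ^ 2) ≤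
          c₀ ^ 2 / (c₀ ^ 2 / 4 + u ^ 2) + 5 * c₀ ^ 2 / (25 * c₀ ^ 2 / 4 + u ^ 2) + 9 * c₀ ^ 2 / 2 / (81 * c₀ ^ 2 / 4 + u ^ 2)) ∧
      (∀ c₁ c u : ℝ, 0 < c₁ → c₁ ≤ c → 9 * c₁ ^ 2 / (9 * c₁ ^ 2 + u ^ 2) ≤ 9 * c ^ 2 / (9 * c ^ 2 + u ^ 2)) := by
  exact Summit.RiemannHypothesis.RiemannHypothesis.Theorems.stub_archOddLowerPrep

/-- Registered ARCH sub-goal `stub_archEvenUpper` (see the landed file for the documentation). -/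
theorem stub_archEvenUpper :
    ∀ b : ℝ, 0 < b → b ≤ Real.log 2 / 2 →
        weilGroundEnergy b ≤ -Real.log b + (Real.pi / 2 + Real.log 2 + 15 / 16 * (248 / 225) - 5.3716) + (35 / 12 * b + b ^ 2 / 12 + 11 / 30 * b ^ 3 + 3 / 1000 * b ^ 5) := by
  exact Summit.RiemannHypothesis.RiemannHypothesis.Theorems.stub_archEvenUpper

/-- Registered ARCH sub-goal `stub_archOddLower` (see the landed file for the documentation). -/
theorem stub_archOddLower :
    (∀ c : ℝ, 0 < c → c ≤ (1 / 5) → ∀ g : ℝ → ℂ, IsWeilTest g → tsupport g ⊆ Icc (-c) c →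
        (∀ x, g (-x) = -g x) → ∫ x, ‖g x‖ ^ 2 = (1 : ℝ) →
        -Real.log c + ((-(122379 / 100000))) ≤ (weilQuadratic g).re) ∧
      (∀ c : ℝ, (1 / 5) ≤ c → c ≤ (1 / 4) → ∀ g : ℝ → ℂ, IsWeilTest g → tsupport g ⊆ Icc (-c) c →
        (∀ x, g (-x) = -g x) → ∫ x, ‖g x‖ ^ 2 = (1 : ℝ) →
        -Real.log c + ((-(29627 / 25000))) ≤ (weilQuadratic g).re) ∧
      (∀ c : ℝ, (1 / 4) ≤ c → c ≤ (27 / 100) → ∀ g : ℝ → ℂ, IsWeilTest g → tsupport g ⊆ Icc (-c) c →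
        (∀ x, g (-x) = -g x) → ∫ x, ‖g x‖ ^ 2 = (1 : ℝ) →
        -Real.log c + ((-(7317 / 6250))) ≤ (weilQuadratic g).re) ∧
      (∀ c : ℝ, (27 / 100) ≤ c → c ≤ (7 / 25) → ∀ g : ℝ → ℂ, IsWeilTest g → tsupport g ⊆ Icc (-c) c →
        (∀ x, g (-x) = -g x) → ∫ x, ‖g x‖ ^ 2 = (1 : ℝ) →
        -Real.log c + ((-(58349 / 50000))) ≤ (weilQuadratic g).re) := by
  exact Summit.RiemannHypothesis.RiemannHypothesis.Theorems.stub_archOddLower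

/-- **ORDER at every window, from ARCH below the first prime and ORDER-LARGE above it**
(real proof; `weilWindowSimpleEven_iff_oddSectorGap`). -/
theorem oddSectorGap_of_stubs :
    ∀ a : ℝ, 0 < a → ∃ δ : ℝ, 0 < δ ∧ ∀ g : ℝ → ℂ, IsWeilTest g → tsupport g ⊆ Icc (-a) a →
      ∫ t, ‖g t‖ ^ 2 = (1 : ℝ) → (∀ t, g (-t) = -g t) →
        weilGroundEnergy a + δ ≤ (weilQuadratic g).re := by
  intro a ha
  rcases le_or_gt a (Real.log 2 / 2) with hle | hlt
  · exact (Summit.RiemannHypothesis.RiemannHypothesis.Theorems.GroundStateSimpleEven.weilWindowSimpleEven_iff_oddSectorGap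
      ha).1 (stub_archimedeanWindows a ha hle)
  · exact stub_oddSectorGap_large a hlt

/-- **STUB COMPACT (even-sector compactness under one linear constraint; LANDED p106119).** Let
`a > 0` and `w ∈ L²`. If for every `δ > 0` there is an `L²`-normalised EVEN window test function `g`
with `∫ conj w · g = 0` and `Re Q(g) < ε(a) + δ`, then there is an EVEN ground state `u` at window `a`
with `∫ conj w · u = 0` (CCM25 Thm 3.6, `ConnesConsaniMoscovici2025_thm_3_6_holds`). -/
theorem stub_evenGroundState_of_constrainedMinimisers :
    ∀ a : ℝ, 0 < a → ∀ w : ℝ → ℂ, MemLp w 2 →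
      (∀ δ : ℝ, 0 < δ → ∃ g : ℝ → ℂ, IsWeilTest g ∧ tsupport g ⊆ Icc (-a) a ∧
        ∫ t, ‖g t‖ ^ 2 = (1 : ℝ) ∧ (∀ t, g (-t) = g t) ∧ ∫ t, starRingEnd ℂ (w t) * g t = 0 ∧
        (weilQuadratic g).re < weilGroundEnergy a + δ) →
      ∃ u : ℝ → ℂ, IsWeilGroundState a u ∧ (∀ t, u (-t) = u t) ∧
        ∫ t, starRingEnd ℂ (w t) * u t = 0 :=
  -- LANDED (wave 1 of lead a1, p106119): Theorems/WeilGroundStateGroundStateSimpleEvenStubCompact.lean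
  Summit.RiemannHypothesis.RiemannHypothesis.Theorems.stub_evenGroundState_of_constrainedMinimisers

/-- **STUB (OP) — odd-primitive approximants (provable now; INTERTWINE machinery reversed).** Let
`u₁, u₂` be EVEN ground states at window `a > 0` and `c₁ c₂ : ℂ` with `∫ (c₂u₁ − c₁u₂) = 0`, and
put `U(t) = ∫_{-a}^t (c₂u₁ − c₁u₂)` (odd, continuous, vanishing off the window).  Then there are
ODD window test functions `oₙ → U` in `L²` with `∫ |oₙ'|²` bounded, along which the weak
eigen-equation holds in the limit against every ODD window test `χ`:
`W(oₙ ⋆ χ̃) → ε(a) ∫ U conj χ`.  Route: window tests `Pₙ → c₂u₁ − c₁u₂` in `L²` (minimising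
sequences), mean-zero correction `kₙ = Pₙ − (∫Pₙ)β`, window primitives `hₙ = ∫_{-a}^t kₙ → U`
(`integral_norm_sq_primitive_le`), odd parts `oₙ` (still `→ U`, `U` odd; `‖oₙ'‖₂ ≤ ‖kₙ‖₂`); for odd
`χ` with window primitive `ψ` (`exists_windowPrimitive`), `W(hₙ ⋆ χ̃) = −W(kₙ ⋆ ψ̃)`
(`weilFunctional_weilConv_deriv_left`) `→ −ε ∫ (c₂u₁ − c₁u₂) conj ψ`
(`tendsto_weilFunctional_weilConv_of_tendsto_comb`) `= ε ∫ U conj χ` (parts in the limit), and the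
limit transfers from `hₙ` to `oₙ` (`tendsto_weilFunctional_weilConv_of_tendsto_sub`). -/
theorem stub_oddPrimitive_approximants :
    ∀ a : ℝ, 0 < a → ∀ u₁ u₂ : ℝ → ℂ, IsWeilGroundState a u₁ → IsWeilGroundState a u₂ →
      (∀ t, u₁ (-t) = u₁ t) → (∀ t, u₂ (-t) = u₂ t) → ∀ c₁ c₂ : ℂ,
      ∫ t, (c₂ * u₁ t - c₁ * u₂ t) = 0 →
      ∃ o : ℕ → ℝ → ℂ, (∀ n, IsWeilTest (o n) ∧ tsupport (o n) ⊆ Icc (-a) a ∧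
          ∀ t, o n (-t) = -o n t) ∧
        Tendsto (fun n => ∫ t, ‖o n t - ∫ s in (-a)..t, (c₂ * u₁ s - c₁ * u₂ s)‖ ^ 2)
          atTop (𝓝 0) ∧
        (∃ M : ℝ, ∀ n, ∫ t, ‖deriv (o n) t‖ ^ 2 ≤ M) ∧
        ∀ χ : ℝ → ℂ, IsWeilTest χ → tsupport χ ⊆ Icc (-a) a → (∀ t, χ (-t) = -χ t) →
          Tendsto (fun n => weilFunctional (weilConv (o n) (weilReflect χ))) atTop
            (𝓝 ((weilGroundEnergy a : ℂ) *
              ∫ t, (∫ s in (-a)..t, (c₂ * u₁ s - c₁ * u₂ s)) * starRingEnd ℂ (χ t))) :=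
  -- LANDED (wave 1 of lead c1, p135663): Theorems/WeilGroundStateGroundStateSimpleEvenStubOddPrimitive.lean
  Summit.RiemannHypothesis.RiemannHypothesis.Theorems.stub_oddPrimitive_approximants

/-- **STUB (PC1) — pair continuity, polar and prime part (provable now).** For `a > 0` there is
`C ≥ 0` such that for all window test functions `f, h` the kernel `K = f ⋆ h̃` (a test function
living on `[-2a, 2a]`, `sup |K| ≤ ‖f‖₂‖h‖₂` by Cauchy–Schwarz, `K(0) = ∫ f conj h`) satisfies
`‖K̂(0) + K̂(1)‖ + ‖Σ Λ(n)n^{-1/2}(K(log n) + K(−log n))‖ + ‖K(0)‖ ≤ C ‖f‖₂ ‖h‖₂`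
(finitely many prime powers `log n < 2a`, `weilPrimeIndex`; `‖K̂(σ)‖ ≤ 4a e^{a} sup|K|` or
`K̂ = f̂ · (h̃)^` with `norm_weilMellin_le_of_ae_eq_zero`). -/
theorem stub_pairContinuity_polarPrime :
    ∀ a : ℝ, 0 < a → ∃ C : ℝ, 0 ≤ C ∧ ∀ f h : ℝ → ℂ, IsWeilTest f → tsupport f ⊆ Icc (-a) a →
      IsWeilTest h → tsupport h ⊆ Icc (-a) a →
        ‖weilPolarTerm (weilConv f (weilReflect h))‖ +
            ‖weilPrimeTerm (weilConv f (weilReflect h))‖ + ‖weilConv f (weilReflect h) 0‖ ≤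
          C * √(∫ t, ‖f t‖ ^ 2) * √(∫ t, ‖h t‖ ^ 2) :=
  -- LANDED (wave 1 of lead c1, p135583): Theorems/WeilGroundStateGroundStateSimpleEvenStubPairContinuityPolarPrime.lean
  Summit.RiemannHypothesis.RiemannHypothesis.Theorems.stub_pairContinuity_polarPrime

/-- **STUB (PC2) — pair continuity, archimedean part (provable now).** For `a > 0` there is
`C ≥ 0` such that for all window test functions `f, h`:
`‖∫ (f ⋆ h̃)^(1/2 + it) Re ψ(1/4 + it/2) dt‖ ≤ C ‖f‖₂ (‖h‖₂ + ‖h'‖₂)`.  Route: `(f ⋆ h̃)^ = f̂·(h̃)^`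
(`weilMellin_weilConv_holds`, `weilMellin_weilReflect_holds`), Cauchy–Schwarz on the line,
Plancherel `∫|ĝ(1/2+it)|² = 2π‖g‖₂²` (`integral_norm_sq_weilMellin_half_line`),
`(h')^(1/2+it) = −it ĥ(1/2+it)` (`weilMellin_deriv`) and `|Re ψ(1/4+it/2)| ≤ C₀ + log(1+|t|/2)`
(`exists_norm_digamma_vertical_le`), so `∫|ĥ|² (Re ψ)² ≤ 2π(2C₀²‖h‖₂² + ½‖h'‖₂²)`. -/
theorem stub_pairContinuity_arch :
    ∀ a : ℝ, 0 < a → ∃ C : ℝ, 0 ≤ C ∧ ∀ f h : ℝ → ℂ, IsWeilTest f → tsupport f ⊆ Icc (-a) a →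
      IsWeilTest h → tsupport h ⊆ Icc (-a) a →
        ‖weilArchIntegral (weilConv f (weilReflect h))‖ ≤
          C * √(∫ t, ‖f t‖ ^ 2) * (√(∫ t, ‖h t‖ ^ 2) + √(∫ t, ‖deriv h t‖ ^ 2)) :=
  -- LANDED (wave 1 of lead c1, p135667): Theorems/WeilGroundStateGroundStateSimpleEvenStubPairContinuityArch.lean
  Summit.RiemannHypothesis.RiemannHypothesis.Theorems.stub_pairContinuity_arch

/-- **STUB (PC) — pair continuity assembled (lead; from (PC1), (PC2)).** For `a > 0` there is
`C ≥ 0` with `‖W(f ⋆ h̃)‖ ≤ C ‖f‖₂ (‖h‖₂ + ‖h'‖₂)` for all window test functions `f, h`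
(`W = polar − prime + (2π)⁻¹ arch − K(0) log π`): the Weil form is bounded on `L² × H¹` of the
window. -/
theorem stub_pairContinuity :
    ∀ a : ℝ, 0 < a → ∃ C : ℝ, 0 ≤ C ∧ ∀ f h : ℝ → ℂ, IsWeilTest f → tsupport f ⊆ Icc (-a) a →
      IsWeilTest h → tsupport h ⊆ Icc (-a) a →
        ‖weilFunctional (weilConv f (weilReflect h))‖ ≤
          C * √(∫ t, ‖f t‖ ^ 2) * (√(∫ t, ‖h t‖ ^ 2) + √(∫ t, ‖deriv h t‖ ^ 2)) :=
  -- LANDED (lead c1, p135917): Theorems/WeilGroundStateGroundStateSimpleEvenStubPairPrelim.lean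
  Summit.RiemannHypothesis.RiemannHypothesis.Theorems.stub_pairContinuity

/-- **STUB (NZ) — the window primitive is non-zero (lead).** For ground states `u₁ ⊥ u₂` at
window `a`, `(c₁, c₂) ≠ 0` and `∫ (c₂u₁ − c₁u₂) = 0`, the window primitive
`U = ∫_{-a}^t (c₂u₁ − c₁u₂)` has `∫|U|² > 0` (otherwise all interval integrals of `c₂u₁ − c₁u₂`
vanish, so `c₂u₁ = c₁u₂` a.e. — impossible for an orthonormal pair). -/
theorem stub_windowPrimitive_ne_zero :
    ∀ a : ℝ, ∀ u₁ u₂ : ℝ → ℂ, IsWeilGroundState a u₁ → IsWeilGroundState a u₂ →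
      ∫ t, starRingEnd ℂ (u₁ t) * u₂ t = 0 → ∀ c₁ c₂ : ℂ, (c₁ ≠ 0 ∨ c₂ ≠ 0) →
      ∫ t, (c₂ * u₁ t - c₁ * u₂ t) = 0 →
        0 < ∫ t, ‖∫ s in (-a)..t, (c₂ * u₁ s - c₁ * u₂ s)‖ ^ 2 :=
  -- LANDED (lead c1, p135917): Theorems/WeilGroundStateGroundStateSimpleEvenStubPairPrelim.lean
  Summit.RiemannHypothesis.RiemannHypothesis.Theorems.stub_windowPrimitive_ne_zero

/-- **STUB PAIR (lead c1; from (OP), (PC), (NZ)).** Two `L²`-orthogonal EVEN ground states at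
the same window `a > 0` yield an ODD `L²`-normalised minimising sequence of window test functions,
`Re Q(oₙ) → ε(a)`.  Proof in the lead's file: choose `(c₁, c₂) ≠ 0` with `∫ (c₂u₁ − c₁u₂) = 0`;
the odd window primitive `U` of `c₂u₁ − c₁u₂` is non-zero (else `c₂u₁ = c₁u₂` a.e., impossible for
an orthonormal pair); with the approximants `oₙ` of (OP) and the pair continuity
`‖W(f ⋆ h̃)‖ ≤ C‖f‖₂(‖h‖₂ + ‖h'‖₂)` assembled from (PC1), (PC2):
`|W(oₙ ⋆ õₙ) − ε‖oₙ‖²| ≤ (C(‖oₙ‖₂ + ‖oₙ'‖₂) + |ε|‖oₙ‖₂) ‖oₙ − U‖₂ → 0`, i.e. `q(oₙ) → 0`;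
normalise (`∫|oₙ|² → ∫|U|² > 0`). -/
theorem stub_oddMinimisers_of_evenPair :
    ∀ a : ℝ, 0 < a → ∀ u₁ u₂ : ℝ → ℂ, IsWeilGroundState a u₁ → IsWeilGroundState a u₂ →
      (∀ t, u₁ (-t) = u₁ t) → (∀ t, u₂ (-t) = u₂ t) → ∫ t, starRingEnd ℂ (u₁ t) * u₂ t = 0 →
        ∃ o : ℕ → ℝ → ℂ, (∀ n, IsWeilTest (o n) ∧ tsupport (o n) ⊆ Icc (-a) a ∧
          ∫ t, ‖o n t‖ ^ 2 = (1 : ℝ) ∧ ∀ t, o n (-t) = -o n t) ∧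
          Tendsto (fun n => (weilQuadratic (o n)).re) atTop (𝓝 (weilGroundEnergy a)) :=
  -- LANDED (lead c1, p136135): Theorems/WeilGroundStateGroundStateSimpleEvenStubPair.lean
  Summit.RiemannHypothesis.RiemannHypothesis.Theorems.stub_oddMinimisers_of_evenPair

/-! ## The composition (real proofs) -/

/-- **The halving theorem, window-wise (kernel-checked).** At a window `a > 0`: ORDER (odd gap),
COMPACT (constrained even compactness) and PAIR (an orthogonal even ground-state pair yields odd
minimisers) imply `WeilWindowSimpleEven a`, with witness an even ground state `u₁`.  Reusable under
any re-cut of the crux to a set of windows. -/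
theorem weilWindowSimpleEven_of_order_of_oddMinimisers {a : ℝ} (ha : 0 < a)
    (horder : ∃ δ : ℝ, 0 < δ ∧ ∀ g : ℝ → ℂ, IsWeilTest g → tsupport g ⊆ Icc (-a) a →
      ∫ t, ‖g t‖ ^ 2 = (1 : ℝ) → (∀ t, g (-t) = -g t) →
        weilGroundEnergy a + δ ≤ (weilQuadratic g).re)
    (hcompact : ∀ w : ℝ → ℂ, MemLp w 2 →
      (∀ δ : ℝ, 0 < δ → ∃ g : ℝ → ℂ, IsWeilTest g ∧ tsupport g ⊆ Icc (-a) a ∧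
        ∫ t, ‖g t‖ ^ 2 = (1 : ℝ) ∧ (∀ t, g (-t) = g t) ∧ ∫ t, starRingEnd ℂ (w t) * g t = 0 ∧
        (weilQuadratic g).re < weilGroundEnergy a + δ) →
      ∃ u : ℝ → ℂ, IsWeilGroundState a u ∧ (∀ t, u (-t) = u t) ∧
        ∫ t, starRingEnd ℂ (w t) * u t = 0)
    (hpair : ∀ u₁ u₂ : ℝ → ℂ, IsWeilGroundState a u₁ → IsWeilGroundState a u₂ →
      (∀ t, u₁ (-t) = u₁ t) → (∀ t, u₂ (-t) = u₂ t) → ∫ t, starRingEnd ℂ (u₁ t) * u₂ t = 0 →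
        ∃ o : ℕ → ℝ → ℂ, (∀ n, IsWeilTest (o n) ∧ tsupport (o n) ⊆ Icc (-a) a ∧
          ∫ t, ‖o n t‖ ^ 2 = (1 : ℝ) ∧ ∀ t, o n (-t) = -o n t) ∧
          Tendsto (fun n => (weilQuadratic (o n)).re) atTop (𝓝 (weilGroundEnergy a))) :
    WeilWindowSimpleEven a := by
  obtain ⟨δ₁, hδ₁, hodd⟩ := horder
  -- (1) the odd sector is gapped, so the even sector attains `ε(a)`: even near-minimisers exist
  have hevenAtt : ∀ δ : ℝ, 0 < δ → ∃ g : ℝ → ℂ, IsWeilTest g ∧ tsupport g ⊆ Icc (-a) a ∧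
      ∫ t, ‖g t‖ ^ 2 = (1 : ℝ) ∧ (∀ t, g (-t) = g t) ∧
      ∫ t, starRingEnd ℂ ((0 : ℝ → ℂ) t) * g t = 0 ∧
      (weilQuadratic g).re < weilGroundEnergy a + δ := by
    intro δ hδ
    by_contra hne
    refine bottom_attained_in_a_sector ha (lt_min hδ hδ₁) (fun g hg hs hn hg' => ?_)
      (fun g hg hs hn hev => ?_)
    · have h1 := hodd g hg hs hn hg'
      have h2 := min_le_right δ δ₁
      linarith
    · by_contra hlt
      refine hne ⟨g, hg, hs, hn, hev, by simp, ?_⟩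
      have h2 := min_le_left δ δ₁
      have h3 := not_le.1 hlt
      linarith
  -- (2) an even ground state `u₁` (COMPACT with the void constraint `w = 0`)
  obtain ⟨u₁, hu₁, hu₁ev, -⟩ := hcompact 0 MemLp.zero hevenAtt
  -- (3) the even sector orthogonal to `u₁` is gapped; otherwise a second even ground state `u₂ ⊥ u₁`
  --     exists (COMPACT), PAIR produces odd minimisers, contradicting the odd gap
  have hgap : ∃ δ₂ : ℝ, 0 < δ₂ ∧ ∀ g : ℝ → ℂ, IsWeilTest g → tsupport g ⊆ Icc (-a) a →
      ∫ t, ‖g t‖ ^ 2 = (1 : ℝ) → (∀ t, g (-t) = g t) → ∫ t, starRingEnd ℂ (u₁ t) * g t = 0 →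
      weilGroundEnergy a + δ₂ ≤ (weilQuadratic g).re := by
    by_contra hno
    have hnear : ∀ δ : ℝ, 0 < δ → ∃ g : ℝ → ℂ, IsWeilTest g ∧ tsupport g ⊆ Icc (-a) a ∧
        ∫ t, ‖g t‖ ^ 2 = (1 : ℝ) ∧ (∀ t, g (-t) = g t) ∧ ∫ t, starRingEnd ℂ (u₁ t) * g t = 0 ∧
        (weilQuadratic g).re < weilGroundEnergy a + δ := by
      intro δ hδ
      by_contra hne
      refine hno ⟨δ, hδ, fun g hg hs hn hev horth => ?_⟩
      by_contra hlt
      exact hne ⟨g, hg, hs, hn, hev, horth, not_le.1 hlt⟩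
    obtain ⟨u₂, hu₂, hu₂ev, horth⟩ := hcompact u₁ hu₁.memLp hnear
    obtain ⟨o, ho, hlim⟩ := hpair u₁ u₂ hu₁ hu₂ hu₁ev hu₂ev horth
    have hge : ∀ n, weilGroundEnergy a + δ₁ ≤ (weilQuadratic (o n)).re :=
      fun n => hodd (o n) (ho n).1 (ho n).2.1 (ho n).2.2.1 (ho n).2.2.2
    have hle : weilGroundEnergy a + δ₁ ≤ weilGroundEnergy a := ge_of_tendsto' hlim hge
    linarith
  obtain ⟨δ₂, hδ₂, heven⟩ := hgap
  -- (4) witness `φ = u₁`, gap `min δ₁ δ₂`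
  refine ⟨u₁, min δ₁ δ₂, lt_min hδ₁ hδ₂, fun g hg hs hn hpar => ?_⟩
  rcases hpar with hg' | ⟨hev, horth⟩
  · have h1 := hodd g hg hs hn hg'
    have h2 := min_le_left δ₁ δ₂
    linarith
  · have h1 := heven g hg hs hn hev horth
    have h2 := min_le_right δ₁ δ₂
    linarith

/-- **The halving theorem with COMPACT discharged (kernel-checked).** At a window `a > 0`, ORDER
and PAIR already imply `WeilWindowSimpleEven a`
(`Theorems.stub_evenGroundState_of_constrainedMinimisers`, p106119, supplies COMPACT). -/
theorem weilWindowSimpleEven_of_oddGap_of_oddMinimisers {a : ℝ} (ha : 0 < a)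
    (horder : ∃ δ : ℝ, 0 < δ ∧ ∀ g : ℝ → ℂ, IsWeilTest g → tsupport g ⊆ Icc (-a) a →
      ∫ t, ‖g t‖ ^ 2 = (1 : ℝ) → (∀ t, g (-t) = -g t) →
        weilGroundEnergy a + δ ≤ (weilQuadratic g).re)
    (hpair : ∀ u₁ u₂ : ℝ → ℂ, IsWeilGroundState a u₁ → IsWeilGroundState a u₂ →
      (∀ t, u₁ (-t) = u₁ t) → (∀ t, u₂ (-t) = u₂ t) → ∫ t, starRingEnd ℂ (u₁ t) * u₂ t = 0 →
        ∃ o : ℕ → ℝ → ℂ, (∀ n, IsWeilTest (o n) ∧ tsupport (o n) ⊆ Icc (-a) a ∧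
          ∫ t, ‖o n t‖ ^ 2 = (1 : ℝ) ∧ ∀ t, o n (-t) = -o n t) ∧
          Tendsto (fun n => (weilQuadratic (o n)).re) atTop (𝓝 (weilGroundEnergy a))) :
    WeilWindowSimpleEven a :=
  weilWindowSimpleEven_of_order_of_oddMinimisers ha horder
    (Summit.RiemannHypothesis.RiemannHypothesis.Theorems.stub_evenGroundState_of_constrainedMinimisers
      a ha)
    hpair

/-- **STUB (HALVING) — registered name of the window-wise halving theorem with COMPACT and PAIR
discharged**: at every window `a > 0`, ORDER(a) alone implies `WeilWindowSimpleEven a`.  (Proved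
here from the stubs; landed as `Theorems.stub_weilWindowSimpleEven_of_oddSectorGap` in
`…GroundStateSimpleEvenOfOddSectorGap.lean` together with the equivalences "parity decides" /
"evenness decides".) -/
theorem stub_weilWindowSimpleEven_of_oddSectorGap :
    ∀ a : ℝ, 0 < a →
      (∃ δ : ℝ, 0 < δ ∧ ∀ g : ℝ → ℂ, IsWeilTest g → tsupport g ⊆ Icc (-a) a →
        ∫ t, ‖g t‖ ^ 2 = (1 : ℝ) → (∀ t, g (-t) = -g t) →
          weilGroundEnergy a + δ ≤ (weilQuadratic g).re) →
      WeilWindowSimpleEven a :=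
  -- LANDED (lead c1, p136723): Theorems/WeilGroundStateGroundStateSimpleEvenOfOddSectorGap.lean
  -- (= `fun a ha horder => weilWindowSimpleEven_of_oddGap_of_oddMinimisers ha horder
  --      (stub_oddMinimisers_of_evenPair a ha)`, kernel-checked below)
  Summit.RiemannHypothesis.RiemannHypothesis.Theorems.stub_weilWindowSimpleEven_of_oddSectorGap

/-- **STUB (CELL) — cell transfer (lead; the actionable re-cut).** For `0 < b ≤ c`, one
`L²`-normalised window-`b` test function of energy `≤ U` (so `ε(b) ≤ U`) and a certified lower bound
`L > U` for the `L²`-normalised ODD window-`c` test functions give `WeilWindowSimpleEven a` for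
EVERY `a ∈ [b, c]`: both sector bottoms are antitone in the window, so the odd sector is gapped by
`L − U` on the whole cell, and HALVING concludes.  A finite chain of cells gives the crux on a
bounded range of windows from finitely many certificates — with NO lower bound for the even sector
orthogonal to the ground state (the expensive half of an item-1529-style certificate). -/
theorem stub_cellTransfer :
    ∀ b c U L : ℝ, 0 < b → U < L →
      (∃ e : ℝ → ℂ, IsWeilTest e ∧ tsupport e ⊆ Icc (-b) b ∧ ∫ t, ‖e t‖ ^ 2 = (1 : ℝ) ∧
        (weilQuadratic e).re ≤ U) →
      (∀ g : ℝ → ℂ, IsWeilTest g → tsupport g ⊆ Icc (-c) c → ∫ t, ‖g t‖ ^ 2 = (1 : ℝ) →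
        (∀ t, g (-t) = -g t) → L ≤ (weilQuadratic g).re) →
      ∀ a : ℝ, b ≤ a → a ≤ c → WeilWindowSimpleEven a :=
  -- LANDED (lead c1, p137020): Theorems/WeilGroundStateGroundStateSimpleEvenCellTransfer.lean
  Summit.RiemannHypothesis.RiemannHypothesis.Theorems.stub_cellTransfer

/-! **CELL-1/3 (LANDED p137081, `Theorems/WeilGroundStateGroundStateSimpleEvenCellThird.lean`,
`Theorems.stub_cellThirdLogTwoHalf : ∀ a, 1/3 ≤ a → a ≤ (log 2)/2 → WeilWindowSimpleEven a`):** the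
crux on the whole cell `[1/3, (log 2)/2]` — UPPER `ε(1/3) ≤ 3/200` by the parabolic bump of item 1529
(supported in `[-1/3, 1/3]`; no prime enters below `(log 2)/2`), LOWER `Re Q ≥ 1/20` on the odd sector
at `(log 2)/2` (odd branch of the kernel-checked gap certificate `weilGapCert`), CELL transfer.  Not
imported here only to keep the workfile's import closure small; proved windows of the crux are now
`(0, 1/100] ∪ [1/3, (log 2)/2]`. -/

/-- **COMPOSITION.** The crux `GroundStateSimpleEven` (= `∀ a > 0, WeilWindowSimpleEven a`) from
ORDER, COMPACT and PAIR, by the window-wise halving theorem.  No `sorry` here; the conclusion is the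
route decl `Summit.RiemannHypothesis.RiemannHypothesis.Theses.WeilGroundState.GroundStateSimpleEven`
by name. -/
theorem GroundStateSimpleEven_of :
    (∀ a : ℝ, 0 < a → ∃ δ : ℝ, 0 < δ ∧ ∀ g : ℝ → ℂ, IsWeilTest g → tsupport g ⊆ Icc (-a) a →
      ∫ t, ‖g t‖ ^ 2 = (1 : ℝ) → (∀ t, g (-t) = -g t) →
        weilGroundEnergy a + δ ≤ (weilQuadratic g).re) →
    (∀ a : ℝ, 0 < a → ∀ w : ℝ → ℂ, MemLp w 2 →
      (∀ δ : ℝ, 0 < δ → ∃ g : ℝ → ℂ, IsWeilTest g ∧ tsupport g ⊆ Icc (-a) a ∧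
        ∫ t, ‖g t‖ ^ 2 = (1 : ℝ) ∧ (∀ t, g (-t) = g t) ∧ ∫ t, starRingEnd ℂ (w t) * g t = 0 ∧
        (weilQuadratic g).re < weilGroundEnergy a + δ) →
      ∃ u : ℝ → ℂ, IsWeilGroundState a u ∧ (∀ t, u (-t) = u t) ∧
        ∫ t, starRingEnd ℂ (w t) * u t = 0) →
    (∀ a : ℝ, 0 < a → ∀ u₁ u₂ : ℝ → ℂ, IsWeilGroundState a u₁ → IsWeilGroundState a u₂ →
      (∀ t, u₁ (-t) = u₁ t) → (∀ t, u₂ (-t) = u₂ t) → ∫ t, starRingEnd ℂ (u₁ t) * u₂ t = 0 →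
        ∃ o : ℕ → ℝ → ℂ, (∀ n, IsWeilTest (o n) ∧ tsupport (o n) ⊆ Icc (-a) a ∧
          ∫ t, ‖o n t‖ ^ 2 = (1 : ℝ) ∧ ∀ t, o n (-t) = -o n t) ∧
          Tendsto (fun n => (weilQuadratic (o n)).re) atTop (𝓝 (weilGroundEnergy a))) →
    Summit.RiemannHypothesis.RiemannHypothesis.Theses.WeilGroundState.GroundStateSimpleEven := by
  intro horder hcompact hpair a ha
  exact weilWindowSimpleEven_of_order_of_oddMinimisers ha (horder a ha) (hcompact a ha) (hpair a ha)

/-- The composition instantiated with the stubs (sanity check that the stub statements are exactly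
the hypotheses of `GroundStateSimpleEven_of`; inherits their `sorry`s and is not itself a stub). -/
theorem groundStateSimpleEven_of_stubs :
    Summit.RiemannHypothesis.RiemannHypothesis.Theses.WeilGroundState.GroundStateSimpleEven :=
  GroundStateSimpleEven_of oddSectorGap_of_stubs stub_evenGroundState_of_constrainedMinimisers
    stub_oddMinimisers_of_evenPair

/-- **v6: the crux from the single open stub NPC by the landed calibration** (sanity check that
`stub_noParityCrossing` is consumed verbatim as `Theses.WeilParity.NoParityCrossing`; inherits its
`sorry`). -/
theorem groundStateSimpleEven_of_stub_noParityCrossing :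
    Summit.RiemannHypothesis.RiemannHypothesis.Theses.WeilGroundState.GroundStateSimpleEven :=
  Summit.RiemannHypothesis.RiemannHypothesis.Theorems.GroundStateSimpleEven.groundStateSimpleEven_of_noParityCrossing
    stub_noParityCrossing

/-- **v6 calibration (LANDED p156985, restated here): the crux ↔ item 18085.** -/
theorem groundStateSimpleEven_iff_noParityCrossing :
    Summit.RiemannHypothesis.RiemannHypothesis.Theses.WeilGroundState.GroundStateSimpleEven ↔
      ∀ a : ℝ, Real.log 3 / 2 < a → weilEvenGroundEnergy a ≠ weilOddGroundEnergy a :=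
  Summit.RiemannHypothesis.RiemannHypothesis.Theorems.GroundStateSimpleEven.groundStateSimpleEven_iff_noParityCrossing

/-- **The crux is equivalent to its odd branch** (the content of the line after v2, modulo the
open stubs): `GroundStateSimpleEven ↔ ∀ a > 0, ORDER(a)`. -/
theorem groundStateSimpleEven_iff_oddSectorGap_of_stubs :
    Summit.RiemannHypothesis.RiemannHypothesis.Theses.WeilGroundState.GroundStateSimpleEven ↔
      ∀ a : ℝ, 0 < a → ∃ δ : ℝ, 0 < δ ∧ ∀ g : ℝ → ℂ, IsWeilTest g → tsupport g ⊆ Icc (-a) a →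
        ∫ t, ‖g t‖ ^ 2 = (1 : ℝ) → (∀ t, g (-t) = -g t) →
          weilGroundEnergy a + δ ≤ (weilQuadratic g).re := by
  refine ⟨fun h a ha => ?_, fun horder =>
    GroundStateSimpleEven_of horder stub_evenGroundState_of_constrainedMinimisers
      stub_oddMinimisers_of_evenPair⟩
  obtain ⟨φ, δ, hδ, hH⟩ := h a ha
  exact ⟨δ, hδ, fun g hg hs hn hodd => hH g hg hs hn (Or.inl hodd)⟩

end Summit.RiemannHypothesis.RiemannHypothesis.Cruxes.GroundStateSimpleEven.ParityMultiplicityCommutator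

end
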